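import Literature.NumberTheory.GaloisRepresentations.AlgebraicHeckeCharacterGrossencharakterProofs
import Literature.NumberTheory.GaloisRepresentations.HeckeCharacterGaloisAvatarProofs
import Literature.NumberTheory.GaloisRepresentations.HeckeCharacterOfRayClass
import HarnessLib

/-!
# Weil's theorem: the `ℓ`-adic character of an algebraic Hecke character (proved)

Topic `NumberTheory/GaloisRepresentations`; namespace
`Literature.NumberTheory.GaloisRepresentations`.  Proof file (theorems with auxiliary constructions;
no named fact, no instance, D-0026).  Second half of the tree's proof of **Weil's theorem** — A. Weil,
*On a certain type of characters of the idèle-class group of an algebraic number-field* (1956) §1–§2;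
Serre, *Abelian ℓ-adic representations* (1968), Ch. II §2.4–2.8 ("the `ℓ`-adic representations
attached to an algebraic Hecke character") — on top of
`AlgebraicHeckeCharacterGrossencharakterProofs` (infinity type on the totally positive ideles, modules of
definition, the Größencharakter on the ray, the `ℓ`-adic congruence) and
`HeckeCharacterGaloisAvatarProofs` (finite-order Hecke characters ↔ Artin characters, from the tree's
proved global class field theory).  Main theorem:

* **`HeckeCharacter.IsAlgebraic.exists_lAdic`** — for an algebraic Hecke character `χ` (type `A₀`,
  `HeckeCharacter.IsAlgebraic`) of a number field `K`, a prime `ℓ` and a field isomorphism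
  `ι : ℚ̄_ℓ ≃+* ℂ`, there is a continuous `r : Γ_K → GL_1(ℚ̄_ℓ)` (`FramedGaloisRep K (PadicAlgCl ℓ) 1`)
  which at every finite place `v ∤ ℓ` where `χ` is unramified is unramified with arithmetic-Frobenius
  characteristic polynomial `X - ι⁻¹(χ(ϖ_v))⁻¹` — i.e. `arithFrobPolyOfSatake ι q_v 1 {χ(ϖ_v)}`
  (`Automorphic/ReciprocityGLn`).  Together with the finite-order case
  (`HeckeCharacter.exists_lAdic_of_isFiniteOrder`) this is the Galois side of the case `n = 1` of
  Harris–Lan–Taylor–Thorne's Theorem A / Theorem 7.13 ("in the case `n = 1` the result is well known",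
  Res. Math. Sci. 3:37 (2016), p. 232).

## The proof (Weil 1956 §2; Serre 1968 Ch. II §2.7–2.8), as formalised

Fix an infinity type `(p, q)` of `χ` (`HasInfinityType`) and a module of definition `(T, e)` supported
on the ramified places (`exists_isModulus_of_ramified`); write `𝔪_N = 𝔪(T,e) · (ℓ^{N+1})`
(`lModulus`), `U_N = {u ∈ ℚ̄_ℓˣ : ‖u - 1‖ ≤ ‖ℓ‖^{N+1}}` (`lOneUnits`), and
`Ψ(𝔞) = ∏_𝔭 ι⁻¹(χ(ϖ_𝔭))^{v_𝔭(𝔞)} ∈ ℚ̄_ℓˣ` (`lAdicIdealPow`, the transport of the Größencharakter `χ̃`).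

* §6 — **`Ψ mod U_N` is a character of the narrow ray class group modulo `𝔪_N`**
  (`mk_lAdicIdealPow_span_eq`, `mk_lAdicIdealPow_eq_of_rayClassRel`: the ray condition of
  `LFunctions.IsRayClassCharacter`, from `idealPow_span_eq` and the `ℓ`-adic congruence
  `norm_ιsymm_archRatio_sub_one_le`); its values form a **finite subgroup `H_N`** of `ℚ̄_ℓˣ/U_N`
  (`lAdicRaySubgroup`, `finite_lAdicRaySubgroup`: the ray class group is finite, Neukirch VI (1.8), and a
  finite torsion set of values closed under products is a group).  For every character `φ` of `H_N`,
  `v ↦ φ(Ψ(𝔭_v) mod U_N)` is a ray class character modulo `𝔪_N` (`isRayClassCharacter_charOfDual`;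
  unique factorisation, `idealPow_charOfDual`), hence a finite-order Hecke character
  (`HeckeCharacter.exists_of_isRayClassCharacter`, Neukirch VII (6.9), (6.14)), hence the Hecke character
  of a rank-one Artin representation `ρ_φ` unramified at the places prime to `𝔪_N` with
  `ρ_φ(Frob_v) = φ(Ψ(𝔭_v) mod U_N)` (`exists_artinRep_of_dual`; class field theory, Tate 5.1).
* §7 — **the level-`N` character `R_N : Γ_K → H_N`** (`levelChar`): the characters of the finite abelian
  group `H_N` separate points (`CommGroup.exists_apply_ne_one_of_hasEnoughRootsOfUnity`), so
  `σ ↦ (det ρ_φ(σ))_φ` (`dualFamilyHom`) determines `R_N` once its image lies in that of `H_N`; it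
  does, because the preimage of the image of `H_N` is an open (finite intersection of open kernels) hence
  closed subgroup of `Γ_K` containing every Frobenius above the places prime to `𝔪_N`, so is all of
  `Γ_K` by Frobenius density (`absoluteGaloisGroup.subgroup_eq_top_of_isClosed_of_frobenius_mem`).
  `R_N` has open kernel, kills inertia above the good places, `R_N(Frob_v) = Ψ(𝔭_v) mod U_N`
  (`levelChar_frob`), and the levels are compatible (`map_levelChar_eq`, same density argument).
* §8 — **passage to the limit**: all values `Ψ(𝔞)` lie in the finite extension
  `E = ℚ_ℓ(ι⁻¹σ_w(θ), ι⁻¹\overline{σ_w}(θ), Ψ(𝔞_i))` of `ℚ_ℓ` (`lAdicIdealPow_mem_lAdicValueField`: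
  `Ψ(𝔞) = Ψ(𝔞_i) · ι⁻¹(∏_w σ_w(b/c)^{p_w} ⋯)⁻¹` for the representative `𝔞_i` of the ray class of `𝔞`),
  which is complete; representatives `a_N(σ) = Ψ(𝔞_{N,σ})` of `R_N(σ)` form a Cauchy sequence
  (`‖a_M - a_N‖ ≤ ‖a_0‖ ‖ℓ‖^{N+1}`), whose limit `R(σ)` (`weilValue`) is multiplicative, nonzero,
  with `‖R(σ) - 1‖ ≤ ‖ℓ‖^{N+1}` on `ker R_N` (continuity, `continuous_weilHom`), trivial on the inertia
  above the good places and equal to `ι⁻¹(χ(ϖ_v))` at their Frobenii (`weilValue_frob`).  The framed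
  representation is `σ ↦ R(σ)⁻¹` (`weilRep`), matching the tree's Frobenius normalisation.

## References

* A. Weil, *On a certain type of characters of the idèle-class group of an algebraic number-field*,
  Proc. Int. Symp. Tokyo–Nikko 1955 (1956), 1–7, §1–§2. [Weil1956]
* J.-P. Serre, *Abelian ℓ-adic representations and elliptic curves* (1968), Ch. II §2.4, §2.7–2.8.
  [SerreAbelianLadic1968]
* J. Neukirch, *Algebraic Number Theory* (1999), Ch. VI §1 (1.7)–(1.9), Ch. VII §6 (6.8)–(6.14).
  [NeukirchANT1999]
* J. Tate, *Global class field theory*, Ch. VII of Cassels–Fröhlich (1967), §5.1. [CasselsFrohlichANT1967]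
* M. Harris, K.-W. Lan, R. Taylor, J. Thorne, Res. Math. Sci. 3:37 (2016), Thm. 7.13, p. 232.
  [HarrisLanTaylorThorneRMS2016]
-/

noncomputable section

open scoped NumberField Topology ComplexConjugate Classical Polynomial
open NumberField IsDedekindDomain Filter Field Polynomial NumberField.InfinitePlace

namespace Literature.NumberTheory.GaloisRepresentations

variable {K : Type} [Field K] [NumberField K]

/-! ### §6. The `λ`-adic Größencharakter modulo the one-units of level `ℓ^{N+1}` is a ray class
character modulo `𝔪 ℓ^{N+1} ∞` -/

section LAdicRay

variable {ℓ : ℕ} [Fact ℓ.Prime]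

/-- Coprimality to a smaller ideal gives coprimality to a larger one. [folklore] -/
theorem _root_.Ideal.isCoprime_of_le {R : Type*} [CommSemiring R] {I J J' : Ideal R} (h : IsCoprime I J)
    (hJ : J ≤ J') : IsCoprime I J' := by
  rw [Ideal.isCoprime_iff_sup_eq] at h ⊢
  exact eq_top_iff.mpr (h ▸ sup_le_sup_left hJ I)

/-- A maximal ideal not containing `𝔪` is prime to it. [folklore] -/
theorem _root_.IsDedekindDomain.HeightOneSpectrum.isCoprime_of_not_le {𝔪 : Ideal (𝓞 K)}
    (v : HeightOneSpectrum (𝓞 K)) (hv : ¬ 𝔪 ≤ v.asIdeal) : IsCoprime v.asIdeal 𝔪 := by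
  rw [Ideal.isCoprime_iff_sup_eq]
  by_contra hne
  exact hv (le_sup_right.trans (v.isMaximal.eq_of_le hne le_sup_left).ge)

variable (ℓ) in
/-- The **one-units of level `ℓ^{N+1}`** of `ℚ̄_ℓ`: `U_N = {u : ‖u - 1‖ ≤ ‖ℓ‖^{N+1}}`. [folklore] -/
def lOneUnits (N : ℕ) : Subgroup (PadicAlgCl ℓ)ˣ :=
  oneUnitsLE (PadicAlgCl ℓ) (‖(ℓ : PadicAlgCl ℓ)‖ ^ (N + 1)) (pow_nonneg (norm_nonneg _) _)
    (norm_natCast_pow_lt_one (Nat.succ_pos N))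

/-- Membership in `lOneUnits`. [folklore] -/
@[simp] theorem mem_lOneUnits_iff {N : ℕ} {u : (PadicAlgCl ℓ)ˣ} :
    u ∈ lOneUnits ℓ N ↔ ‖(u : PadicAlgCl ℓ) - 1‖ ≤ ‖(ℓ : PadicAlgCl ℓ)‖ ^ (N + 1) :=
  Iff.rfl

/-- The levels decrease: `U_M ≤ U_N` for `N ≤ M`. [folklore] -/
theorem lOneUnits_antitone {N M : ℕ} (h : N ≤ M) : lOneUnits ℓ M ≤ lOneUnits ℓ N := by
  intro u hu
  rw [mem_lOneUnits_iff] at hu ⊢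
  exact hu.trans (pow_le_pow_of_le_one (norm_nonneg _) (Automorphic.PadicAlgCl.norm_natCast_p_lt_one ℓ).le
    (Nat.succ_le_succ h))

namespace HeckeCharacter

/-- `ι⁻¹(χ(ϖ_v)) ∈ ℚ̄_ℓˣ`. [folklore] -/
def lAdicValue (χ : HeckeCharacter K) (ι : PadicAlgCl ℓ ≃+* ℂ) (v : HeightOneSpectrum (𝓞 K)) : (PadicAlgCl ℓ)ˣ :=
  Units.mk0 (ι.symm (χ.valueAtUniformizer v)) ((_root_.map_ne_zero ι.symm).mpr (χ.valueAtUniformizer_ne_zero' v))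

/-- Unfolding lemma for `lAdicValue`. [folklore] -/
@[simp] theorem coe_lAdicValue (χ : HeckeCharacter K) (ι : PadicAlgCl ℓ ≃+* ℂ) (v : HeightOneSpectrum (𝓞 K)) :
    (χ.lAdicValue ι v : PadicAlgCl ℓ) = ι.symm (χ.valueAtUniformizer v) :=
  rfl

/-- **The `ℓ`-adic ideal character** `Ψ(𝔞) = ∏_𝔭 ι⁻¹(χ(ϖ_𝔭))^{v_𝔭(𝔞)} ∈ ℚ̄_ℓˣ` of `χ` — the transport
along `ι⁻¹` of the Größencharakter `χ̃ = idealPow (v ↦ χ(ϖ_v))` (`coe_lAdicIdealPow`).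
Ref: Weil 1956 §2; Serre 1968 Ch. II §2.7. [cite: SerreAbelianLadic1968, Ch. II §2.7] -/
def lAdicIdealPow (χ : HeckeCharacter K) (ι : PadicAlgCl ℓ ≃+* ℂ) (I : Ideal (𝓞 K)) : (PadicAlgCl ℓ)ˣ :=
  ∏ᶠ v : HeightOneSpectrum (𝓞 K), χ.lAdicValue ι v ^ (Associates.mk v.asIdeal).count (Associates.mk I).factors

variable (χ : HeckeCharacter K) (ι : PadicAlgCl ℓ ≃+* ℂ)

/-- The product defining `lAdicIdealPow` is finite. [folklore] -/
theorem hasFiniteMulSupport_lAdicIdealPow {I : Ideal (𝓞 K)} (hI : I ≠ ⊥) :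
    Function.HasFiniteMulSupport fun v : HeightOneSpectrum (𝓞 K) =>
      χ.lAdicValue ι v ^ (Associates.mk v.asIdeal).count (Associates.mk I).factors := by
  refine (Filter.eventually_cofinite.mp (Associates.finite_factors hI)).subset fun v hv => ?_
  rw [Function.mem_mulSupport] at hv
  intro h0
  have h0' : (Associates.mk v.asIdeal).count (Associates.mk I).factors = 0 := by exact_mod_cast h0
  exact hv (by rw [h0', pow_zero])

/-- `Ψ(𝔞) = ι⁻¹(χ̃(𝔞))`. [folklore] -/
theorem coe_lAdicIdealPow {I : Ideal (𝓞 K)} (hI : I ≠ ⊥) :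
    (χ.lAdicIdealPow ι I : PadicAlgCl ℓ) = ι.symm (LFunctions.idealPow K (fun v => χ.valueAtUniformizer v) I) := by
  rw [lAdicIdealPow, LFunctions.idealPow, ← Units.coeHom_apply,
    MonoidHom.map_finprod _ (χ.hasFiniteMulSupport_lAdicIdealPow ι hI),
    map_finprod _ (LFunctions.mulSupport_idealPow_finite _ hI)]
  refine finprod_congr fun v => ?_
  rw [map_pow, map_pow, Units.coeHom_apply, coe_lAdicValue]

/-- `Ψ(𝔞 𝔟) = Ψ(𝔞) Ψ(𝔟)` for nonzero ideals. [folklore] -/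
theorem lAdicIdealPow_mul {I J : Ideal (𝓞 K)} (hI : I ≠ ⊥) (hJ : J ≠ ⊥) :
    χ.lAdicIdealPow ι (I * J) = χ.lAdicIdealPow ι I * χ.lAdicIdealPow ι J := by
  apply Units.ext
  rw [Units.val_mul, coe_lAdicIdealPow χ ι hI, coe_lAdicIdealPow χ ι hJ,
    coe_lAdicIdealPow χ ι (mul_ne_zero hI hJ), LFunctions.idealPow_mul _ hI hJ, map_mul]

/-- `Ψ(𝔭) = ι⁻¹(χ(ϖ_𝔭))`. [folklore] -/
theorem lAdicIdealPow_asIdeal (v : HeightOneSpectrum (𝓞 K)) :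
    χ.lAdicIdealPow ι v.asIdeal = χ.lAdicValue ι v := by
  apply Units.ext
  rw [coe_lAdicIdealPow χ ι v.ne_bot, LFunctions.idealPow_asIdeal, coe_lAdicValue]

/-- `Ψ(1) = 1`. [folklore] -/
theorem lAdicIdealPow_top : χ.lAdicIdealPow ι ⊤ = 1 := by
  apply Units.ext
  rw [coe_lAdicIdealPow χ ι top_ne_bot, LFunctions.idealPow_top, map_one, Units.val_one]

/-- `Ψ(𝔞ⁿ) = Ψ(𝔞)ⁿ`. [folklore] -/
theorem lAdicIdealPow_pow {I : Ideal (𝓞 K)} (hI : I ≠ ⊥) (n : ℕ) :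
    χ.lAdicIdealPow ι (I ^ n) = χ.lAdicIdealPow ι I ^ n := by
  induction n with
  | zero => rw [pow_zero, pow_zero, Ideal.one_eq_top, lAdicIdealPow_top]
  | succ n ih => rw [pow_succ, lAdicIdealPow_mul χ ι (pow_ne_zero n hI) hI, ih, pow_succ]

/-! #### The modulus `𝔪_N = 𝔪 · ℓ^{N+1}` -/

variable (T : Finset (HeightOneSpectrum (𝓞 K))) (e : HeightOneSpectrum (𝓞 K) → ℕ)

variable (ℓ) in
/-- The modulus `𝔪_N = 𝔪(T,e) · (ℓ^{N+1})` of level `N`. [folklore] -/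
def lModulus (N : ℕ) : Ideal (𝓞 K) :=
  modulusIdeal T e * Ideal.span {((ℓ : ℕ) : 𝓞 K) ^ (N + 1)}

omit [NumberField K] [Fact ℓ.Prime] in
/-- `𝔪_N ≤ 𝔪`. [folklore] -/
theorem lModulus_le_modulusIdeal (N : ℕ) : lModulus ℓ T e N ≤ modulusIdeal T e :=
  Ideal.mul_le_right

omit [NumberField K] [Fact ℓ.Prime] in
/-- `𝔪_N ≤ (ℓ^{N+1})`. [folklore] -/
theorem lModulus_le_span_pow (N : ℕ) : lModulus ℓ T e N ≤ Ideal.span {((ℓ : ℕ) : 𝓞 K) ^ (N + 1)} :=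
  Ideal.mul_le_left

omit [NumberField K] [Fact ℓ.Prime] in
/-- `𝔪_N ≤ (ℓ)`. [folklore] -/
theorem lModulus_le_span (N : ℕ) : lModulus ℓ T e N ≤ Ideal.span {((ℓ : ℕ) : 𝓞 K)} :=
  (lModulus_le_span_pow T e N).trans
    (Ideal.span_singleton_le_span_singleton.mpr (dvd_pow_self _ (Nat.succ_ne_zero N)))

/-- `𝔪_N ≠ 0`. [folklore] -/
theorem lModulus_ne_bot (N : ℕ) : lModulus ℓ T e N ≠ ⊥ := by
  rw [lModulus, Ne, Ideal.mul_eq_bot, not_or, Ideal.span_singleton_eq_bot]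
  exact ⟨modulusIdeal_ne_bot T e, pow_ne_zero _ (Nat.cast_ne_zero.mpr (Fact.out : ℓ.Prime).ne_zero)⟩

omit [NumberField K] [Fact ℓ.Prime] in
/-- `𝔪_M ≤ 𝔪_N` for `N ≤ M`. [folklore] -/
theorem lModulus_antitone {N M : ℕ} (h : N ≤ M) : lModulus ℓ T e M ≤ lModulus ℓ T e N :=
  Ideal.mul_mono_right (Ideal.span_singleton_le_span_singleton.mpr (pow_dvd_pow _ (Nat.succ_le_succ h)))

omit [Fact ℓ.Prime] in
/-- The primes dividing `𝔪_N` are those of `T` and those above `ℓ`. [folklore] -/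
theorem lModulus_le_asIdeal_iff {N : ℕ} {v : HeightOneSpectrum (𝓞 K)} :
    lModulus ℓ T e N ≤ v.asIdeal ↔ v ∈ T ∨ ((ℓ : ℕ) : 𝓞 K) ∈ v.asIdeal := by
  rw [lModulus, Ideal.IsPrime.mul_le v.isPrime, modulusIdeal_le_iff, Ideal.span_singleton_le_iff_mem]
  refine or_congr Iff.rfl ⟨fun h => v.isPrime.mem_of_pow_mem _ h, fun h => ?_⟩
  exact Ideal.pow_mem_of_mem _ h _ (Nat.succ_pos N)

/-- The set of primes dividing `𝔪_N` is finite. [folklore] -/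
theorem finite_setOf_lModulus_le (N : ℕ) : {v : HeightOneSpectrum (𝓞 K) | lModulus ℓ T e N ≤ v.asIdeal}.Finite :=
  finite_setOf_ideal_le (lModulus_ne_bot T e N)

/-! #### The congruence: `Ψ((b)) ≡ Ψ((c)) mod U_N` on the ray modulo `𝔪_N` -/

variable {χ ι T e}

/-- **The `λ`-adic Größencharakter is a ray class character modulo `𝔪 ℓ^{N+1} ∞`, with values in
`ℚ̄_ℓˣ / U_N`.**  If `χ` has infinity type `(p, q)` and module of definition `(T, e)`, then for
nonzero integers `b ≡ c mod 𝔪_N` with `c` prime to `𝔪_N` and `b/c` totally positive,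
`Ψ((b)) ≡ Ψ((c))` modulo the one-units of level `ℓ^{N+1}` (`idealPow_span_eq` and
`norm_ιsymm_archRatio_sub_one_le`).  Ref: Weil 1956 §2; Serre 1968, Ch. II §2.7–2.8.
[cite: Weil1956, §2] [cite: SerreAbelianLadic1968, Ch. II §2.8] -/
theorem HasInfinityType.mk_lAdicIdealPow_span_eq {p q : InfinitePlace K → ℤ} (hinf : χ.HasInfinityType p q)
    (hmod : IsModulus χ T e) (ι : PadicAlgCl ℓ ≃+* ℂ) {N : ℕ} {b c : 𝓞 K} (hb : b ≠ 0) (hc : c ≠ 0)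
    (hcop : IsCoprime (Ideal.span {c}) (lModulus ℓ T e N)) (hbc : b - c ∈ lModulus ℓ T e N)
    (hpos : ∀ φ : K →+* ℝ, 0 < φ b * φ c) :
    (QuotientGroup.mk (χ.lAdicIdealPow ι (Ideal.span {b})) : (PadicAlgCl ℓ)ˣ ⧸ lOneUnits ℓ N) =
      QuotientGroup.mk (χ.lAdicIdealPow ι (Ideal.span {c})) := by
  have hb0 : (Ideal.span {b} : Ideal (𝓞 K)) ≠ ⊥ := by rwa [Ne, Ideal.span_singleton_eq_bot]
  have hc0 : (Ideal.span {c} : Ideal (𝓞 K)) ≠ ⊥ := by rwa [Ne, Ideal.span_singleton_eq_bot]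
  have hF := hinf.idealPow_span_eq hmod hb hc (Ideal.isCoprime_of_le hcop (lModulus_le_modulusIdeal T e N))
    (lModulus_le_modulusIdeal T e N hbc) hpos
  have hcopℓ : IsCoprime (Ideal.span {c}) (Ideal.span {((ℓ : ℕ) : 𝓞 K)}) :=
    Ideal.isCoprime_of_le hcop (lModulus_le_span T e N)
  have hbcℓ : b - c ∈ Ideal.span {((ℓ : ℕ) : 𝓞 K) ^ (N + 1)} := lModulus_le_span_pow T e N hbc
  have hne : ι.symm (LFunctions.idealPow K (fun v => χ.valueAtUniformizer v) (Ideal.span {c})) ≠ 0 :=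
    (_root_.map_ne_zero _).mpr (idealPow_ne_zero (fun v => χ.valueAtUniformizer_ne_zero' v) _)
  rw [eq_comm, QuotientGroup.eq, mem_lOneUnits_iff, Units.val_mul, Units.val_inv_eq_inv_val,
    coe_lAdicIdealPow χ ι hc0, coe_lAdicIdealPow χ ι hb0, hF, map_mul, ← mul_assoc, inv_mul_cancel₀ hne, one_mul]
  exact norm_ιsymm_archRatio_sub_one_le ι p q (Nat.succ_pos N) hb hc hcopℓ hbcℓ

/-- **Ray-class invariance of `Ψ mod U_N`**: ideals `𝔞, 𝔟` prime to `𝔪_N` in the same narrow ray class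
modulo `𝔪_N` (`LFunctions.RayClassRel`: `(c) 𝔞 = (b) 𝔟` with `b, c` as above) have
`Ψ(𝔞) ≡ Ψ(𝔟) mod U_N`.  Ref: Weil 1956 §2; Neukirch VI (1.7)–(1.9). [cite: Weil1956, §2] -/
theorem HasInfinityType.mk_lAdicIdealPow_eq_of_rayClassRel {p q : InfinitePlace K → ℤ}
    (hinf : χ.HasInfinityType p q) (hmod : IsModulus χ T e) (ι : PadicAlgCl ℓ ≃+* ℂ) {N : ℕ}
    {𝔞 𝔟 : Ideal (𝓞 K)} (h𝔞 : 𝔞 ≠ ⊥) (h𝔟 : 𝔟 ≠ ⊥) (hrel : LFunctions.RayClassRel (lModulus ℓ T e N) 𝔟 𝔞) :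
    (QuotientGroup.mk (χ.lAdicIdealPow ι 𝔞) : (PadicAlgCl ℓ)ˣ ⧸ lOneUnits ℓ N) =
      QuotientGroup.mk (χ.lAdicIdealPow ι 𝔟) := by
  obtain ⟨b, c, hb, hc, hcop, hbc, hpos, heq⟩ := hrel
  have hb0 : (Ideal.span {b} : Ideal (𝓞 K)) ≠ ⊥ := by rwa [Ne, Ideal.span_singleton_eq_bot]
  have hc0 : (Ideal.span {c} : Ideal (𝓞 K)) ≠ ⊥ := by rwa [Ne, Ideal.span_singleton_eq_bot]
  have hbc' := hinf.mk_lAdicIdealPow_span_eq hmod ι hb hc hcop hbc hpos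
  have h1 : χ.lAdicIdealPow ι (Ideal.span {c}) * χ.lAdicIdealPow ι 𝔞 =
      χ.lAdicIdealPow ι (Ideal.span {b}) * χ.lAdicIdealPow ι 𝔟 := by
    rw [← lAdicIdealPow_mul χ ι hc0 h𝔞, ← lAdicIdealPow_mul χ ι hb0 h𝔟, heq]
  have h2 := congrArg (QuotientGroup.mk (s := lOneUnits ℓ N)) h1
  rw [QuotientGroup.mk_mul, QuotientGroup.mk_mul, ← hbc'] at h2
  set a : (PadicAlgCl ℓ)ˣ ⧸ lOneUnits ℓ N := QuotientGroup.mk (χ.lAdicIdealPow ι (Ideal.span {b}))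
  calc (QuotientGroup.mk (χ.lAdicIdealPow ι 𝔞) : (PadicAlgCl ℓ)ˣ ⧸ lOneUnits ℓ N)
        = a⁻¹ * (a * QuotientGroup.mk (χ.lAdicIdealPow ι 𝔞)) := (inv_mul_cancel_left a _).symm
    _ = a⁻¹ * (a * QuotientGroup.mk (χ.lAdicIdealPow ι 𝔟)) := by rw [h2]
    _ = _ := inv_mul_cancel_left a _

/-! #### The finite group `H_N` of values modulo `U_N` -/

variable (χ ι T e)

/-- The class of `Ψ(𝔞)` modulo `U_N`, on the nonzero integral ideals prime to `𝔪_N`. [folklore] -/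
def lAdicRayClassFun (N : ℕ) (𝔞 : LFunctions.CoprimeIdeal (lModulus ℓ T e N)) :
    (PadicAlgCl ℓ)ˣ ⧸ lOneUnits ℓ N :=
  QuotientGroup.mk (χ.lAdicIdealPow ι 𝔞.1)

variable {χ ι T e}

/-- The class function descends to the finite narrow ray class quotient. [folklore] -/
theorem HasInfinityType.lAdicRayClassFun_eq_of_rayClassRel {p q : InfinitePlace K → ℤ}
    (hinf : χ.HasInfinityType p q) (hmod : IsModulus χ T e) (ι : PadicAlgCl ℓ ≃+* ℂ) {N : ℕ}
    {𝔞 𝔟 : LFunctions.CoprimeIdeal (lModulus ℓ T e N)} (h : LFunctions.RayClassRel (lModulus ℓ T e N) 𝔟.1 𝔞.1) :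
    lAdicRayClassFun χ ι T e N 𝔞 = lAdicRayClassFun χ ι T e N 𝔟 :=
  hinf.mk_lAdicIdealPow_eq_of_rayClassRel hmod ι 𝔞.2.1 𝔟.2.1 h

/-- **The values `Ψ(𝔞) mod U_N` form a finite set** (they depend only on the narrow ray class of `𝔞`
modulo `𝔪_N`, and the ray class group is finite, Neukirch VI (1.8)). [cite: NeukirchANT1999, Ch. VI §1 Prop. (1.8)] -/
theorem HasInfinityType.finite_range_lAdicRayClassFun {p q : InfinitePlace K → ℤ}
    (hinf : χ.HasInfinityType p q) (hmod : IsModulus χ T e) (ι : PadicAlgCl ℓ ≃+* ℂ) (N : ℕ) :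
    (Set.range (lAdicRayClassFun χ ι T e N)).Finite := by
  haveI := LFunctions.finite_rayClassQuotient (lModulus_ne_bot T e N (ℓ := ℓ))
  letI := LFunctions.rayClassSetoid (lModulus ℓ T e N)
  set f : Quotient (LFunctions.rayClassSetoid (lModulus ℓ T e N)) → (PadicAlgCl ℓ)ˣ ⧸ lOneUnits ℓ N :=
    Quotient.lift (lAdicRayClassFun χ ι T e N) fun 𝔞 𝔟 h =>
      hinf.lAdicRayClassFun_eq_of_rayClassRel hmod ι ((LFunctions.rayClassSetoid_r_iff 𝔞 𝔟).mp h)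
    with hf
  have hrange : Set.range (lAdicRayClassFun χ ι T e N) = Set.range f := by
    ext x
    constructor
    · rintro ⟨𝔞, rfl⟩
      exact ⟨Quotient.mk _ 𝔞, rfl⟩
    · rintro ⟨y, rfl⟩
      induction y using Quotient.inductionOn with
      | h 𝔞 => exact ⟨𝔞, rfl⟩
  rw [hrange]
  exact Set.finite_range f

omit [NumberField K] [Fact ℓ.Prime] in
/-- Powers of an ideal prime to `𝔪_N` are prime to `𝔪_N`. [folklore] -/
theorem _root_.Literature.NumberTheory.LFunctions.CoprimeIdeal.pow_mem {𝔪 : Ideal (𝓞 K)}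
    (𝔞 : LFunctions.CoprimeIdeal 𝔪) (n : ℕ) : 𝔞.1 ^ n ≠ ⊥ ∧ IsCoprime (𝔞.1 ^ n) 𝔪 :=
  ⟨pow_ne_zero n 𝔞.2.1, 𝔞.2.2.pow_left⟩

omit [NumberField K] [Fact ℓ.Prime] in
/-- Products of ideals prime to `𝔪` are prime to `𝔪`. [folklore] -/
theorem _root_.Literature.NumberTheory.LFunctions.CoprimeIdeal.mul_mem {𝔪 : Ideal (𝓞 K)}
    (𝔞 𝔟 : LFunctions.CoprimeIdeal 𝔪) : 𝔞.1 * 𝔟.1 ≠ ⊥ ∧ IsCoprime (𝔞.1 * 𝔟.1) 𝔪 :=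
  ⟨mul_ne_zero 𝔞.2.1 𝔟.2.1, 𝔞.2.2.mul_left 𝔟.2.2⟩

/-- **Every value `Ψ(𝔞) mod U_N` has finite order** (the classes of the powers `𝔞ⁿ` lie in a finite
set). [folklore] -/
theorem HasInfinityType.isOfFinOrder_lAdicRayClassFun {p q : InfinitePlace K → ℤ}
    (hinf : χ.HasInfinityType p q) (hmod : IsModulus χ T e) (ι : PadicAlgCl ℓ ≃+* ℂ) {N : ℕ}
    (𝔞 : LFunctions.CoprimeIdeal (lModulus ℓ T e N)) :
    IsOfFinOrder (lAdicRayClassFun χ ι T e N 𝔞) := by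
  have hmem : ∀ n : ℕ, lAdicRayClassFun χ ι T e N 𝔞 ^ n ∈ Set.range (lAdicRayClassFun χ ι T e N) := by
    intro n
    refine ⟨⟨𝔞.1 ^ n, 𝔞.pow_mem n⟩, ?_⟩
    simp only [lAdicRayClassFun]
    rw [lAdicIdealPow_pow χ ι 𝔞.2.1, QuotientGroup.mk_pow]
  obtain ⟨i, j, hij, hijeq⟩ :=
    Set.Finite.exists_lt_map_eq_of_forall_mem hmem (hinf.finite_range_lAdicRayClassFun hmod ι N)
  rw [isOfFinOrder_iff_pow_eq_one]
  refine ⟨j - i, Nat.sub_pos_of_lt hij, ?_⟩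
  have : lAdicRayClassFun χ ι T e N 𝔞 ^ j = lAdicRayClassFun χ ι T e N 𝔞 ^ i * lAdicRayClassFun χ ι T e N 𝔞 ^ (j - i) := by
    rw [← pow_add, Nat.add_sub_cancel' hij.le]
  rw [this] at hijeq
  set x := lAdicRayClassFun χ ι T e N 𝔞
  calc x ^ (j - i) = (x ^ i)⁻¹ * (x ^ i * x ^ (j - i)) := (inv_mul_cancel_left _ _).symm
    _ = (x ^ i)⁻¹ * x ^ i := by rw [← hijeq]
    _ = 1 := inv_mul_cancel _

/-- **The finite group `H_N`** of the values `Ψ(𝔞) mod U_N`, `𝔞` prime to `𝔪_N`: the range of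
`lAdicRayClassFun`, a subgroup of `ℚ̄_ℓˣ / U_N` (closed under products; inverses by torsion).
[folklore] -/
def HasInfinityType.lAdicRaySubgroup {p q : InfinitePlace K → ℤ} (hinf : χ.HasInfinityType p q)
    (hmod : IsModulus χ T e) (ι : PadicAlgCl ℓ ≃+* ℂ) (N : ℕ) : Subgroup ((PadicAlgCl ℓ)ˣ ⧸ lOneUnits ℓ N) where
  carrier := Set.range (lAdicRayClassFun χ ι T e N)
  one_mem' := ⟨⟨⊤, top_ne_bot, Ideal.isCoprime_iff_sup_eq.mpr (top_sup_eq _)⟩, by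
    simp only [lAdicRayClassFun]
    rw [lAdicIdealPow_top, QuotientGroup.mk_one]⟩
  mul_mem' := by
    rintro x y ⟨𝔞, rfl⟩ ⟨𝔟, rfl⟩
    refine ⟨⟨𝔞.1 * 𝔟.1, 𝔞.mul_mem 𝔟⟩, ?_⟩
    simp only [lAdicRayClassFun]
    rw [lAdicIdealPow_mul χ ι 𝔞.2.1 𝔟.2.1, QuotientGroup.mk_mul]
  inv_mem' := by
    rintro x ⟨𝔞, rfl⟩
    have hfin := hinf.isOfFinOrder_lAdicRayClassFun hmod ι 𝔞
    have hn := hfin.orderOf_pos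
    refine ⟨⟨𝔞.1 ^ (orderOf (lAdicRayClassFun χ ι T e N 𝔞) - 1), 𝔞.pow_mem _⟩, ?_⟩
    simp only [lAdicRayClassFun]
    rw [lAdicIdealPow_pow χ ι 𝔞.2.1, QuotientGroup.mk_pow, eq_inv_iff_mul_eq_one]
    change lAdicRayClassFun χ ι T e N 𝔞 ^ (orderOf (lAdicRayClassFun χ ι T e N 𝔞) - 1) *
      lAdicRayClassFun χ ι T e N 𝔞 = 1
    rw [← pow_succ, Nat.sub_add_cancel hn, pow_orderOf_eq_one]

/-- `H_N` is finite. [folklore] -/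
theorem HasInfinityType.finite_lAdicRaySubgroup {p q : InfinitePlace K → ℤ} (hinf : χ.HasInfinityType p q)
    (hmod : IsModulus χ T e) (ι : PadicAlgCl ℓ ≃+* ℂ) (N : ℕ) : Finite (hinf.lAdicRaySubgroup hmod ι N) :=
  (hinf.finite_range_lAdicRayClassFun hmod ι N).to_subtype

/-- The element `Ψ(𝔞) mod U_N` of `H_N`. [folklore] -/
def HasInfinityType.lAdicRayClass {p q : InfinitePlace K → ℤ} (hinf : χ.HasInfinityType p q)
    (hmod : IsModulus χ T e) (ι : PadicAlgCl ℓ ≃+* ℂ) (N : ℕ) (𝔞 : LFunctions.CoprimeIdeal (lModulus ℓ T e N)) :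
    hinf.lAdicRaySubgroup hmod ι N :=
  ⟨lAdicRayClassFun χ ι T e N 𝔞, 𝔞, rfl⟩

/-- Unfolding lemma for `lAdicRayClass`. [folklore] -/
@[simp] theorem HasInfinityType.coe_lAdicRayClass {p q : InfinitePlace K → ℤ} (hinf : χ.HasInfinityType p q)
    (hmod : IsModulus χ T e) (ι : PadicAlgCl ℓ ≃+* ℂ) (N : ℕ) (𝔞 : LFunctions.CoprimeIdeal (lModulus ℓ T e N)) :
    ((hinf.lAdicRayClass hmod ι N 𝔞 : hinf.lAdicRaySubgroup hmod ι N) : (PadicAlgCl ℓ)ˣ ⧸ lOneUnits ℓ N) =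
      QuotientGroup.mk (χ.lAdicIdealPow ι 𝔞.1) :=
  rfl

/-- `lAdicRayClass` is multiplicative. [folklore] -/
theorem HasInfinityType.lAdicRayClass_mul {p q : InfinitePlace K → ℤ} (hinf : χ.HasInfinityType p q)
    (hmod : IsModulus χ T e) (ι : PadicAlgCl ℓ ≃+* ℂ) (N : ℕ) (𝔞 𝔟 : LFunctions.CoprimeIdeal (lModulus ℓ T e N)) :
    hinf.lAdicRayClass hmod ι N ⟨𝔞.1 * 𝔟.1, 𝔞.mul_mem 𝔟⟩ =
      hinf.lAdicRayClass hmod ι N 𝔞 * hinf.lAdicRayClass hmod ι N 𝔟 := by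
  apply Subtype.ext
  simp only [coe_lAdicRayClass, Subgroup.coe_mul]
  rw [lAdicIdealPow_mul χ ι 𝔞.2.1 𝔟.2.1, QuotientGroup.mk_mul]

/-! #### The characters of `H_N` as ray class characters, Hecke characters, Artin characters -/

section Dual

variable {p q : InfinitePlace K → ℤ} (hinf : χ.HasInfinityType p q) (hmod : IsModulus χ T e)
  (ι : PadicAlgCl ℓ ≃+* ℂ) (N : ℕ)

/-- The element `Ψ(𝔭_v) mod U_N ∈ H_N` at a place `v` prime to `𝔪_N`. [folklore] -/
def HasInfinityType.lAdicRayClassAt (v : HeightOneSpectrum (𝓞 K)) (hv : IsCoprime v.asIdeal (lModulus ℓ T e N)) :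
    hinf.lAdicRaySubgroup hmod ι N :=
  hinf.lAdicRayClass hmod ι N ⟨v.asIdeal, v.ne_bot, hv⟩

/-- Unfolding lemma for `lAdicRayClassAt`. [folklore] -/
@[simp] theorem HasInfinityType.coe_lAdicRayClassAt (v : HeightOneSpectrum (𝓞 K))
    (hv : IsCoprime v.asIdeal (lModulus ℓ T e N)) :
    ((hinf.lAdicRayClassAt hmod ι N v hv : hinf.lAdicRaySubgroup hmod ι N) : (PadicAlgCl ℓ)ˣ ⧸ lOneUnits ℓ N) =
      QuotientGroup.mk (χ.lAdicValue ι v) := by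
  rw [HasInfinityType.lAdicRayClassAt, HasInfinityType.coe_lAdicRayClass, lAdicIdealPow_asIdeal]

/-- **The ray class character `v ↦ φ(Ψ(𝔭_v) mod U_N)`** attached to a character `φ` of the finite
group `H_N` (value `0` at the primes dividing `𝔪_N`). [folklore] -/
def HasInfinityType.charOfDual (φ : hinf.lAdicRaySubgroup hmod ι N →* ℂˣ) : HeightOneSpectrum (𝓞 K) → ℂ :=
  fun v => if hv : IsCoprime v.asIdeal (lModulus ℓ T e N) then (φ (hinf.lAdicRayClassAt hmod ι N v hv) : ℂ) else 0

/-- Value of `charOfDual` at a place prime to `𝔪_N`. [folklore] -/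
theorem HasInfinityType.charOfDual_apply_of_isCoprime (φ : hinf.lAdicRaySubgroup hmod ι N →* ℂˣ)
    {v : HeightOneSpectrum (𝓞 K)} (hv : IsCoprime v.asIdeal (lModulus ℓ T e N)) :
    hinf.charOfDual hmod ι N φ v = (φ (hinf.lAdicRayClassAt hmod ι N v hv) : ℂ) := by
  simp only [HasInfinityType.charOfDual, dif_pos hv]

omit [Fact ℓ.Prime] in
/-- A prime dividing an ideal prime to `𝔪` is prime to `𝔪`. [folklore] -/
theorem _root_.Literature.NumberTheory.LFunctions.CoprimeIdeal.isCoprime_of_count_ne_zero {𝔪 : Ideal (𝓞 K)}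
    (𝔞 : LFunctions.CoprimeIdeal 𝔪) {v : HeightOneSpectrum (𝓞 K)}
    (hv : (Associates.mk v.asIdeal).count (Associates.mk 𝔞.1).factors ≠ 0) : IsCoprime v.asIdeal 𝔪 := by
  have hdvd : v.asIdeal ∣ 𝔞.1 := (Associates.count_ne_zero_iff_dvd 𝔞.2.1 v.irreducible).mp hv
  exact (Ideal.isCoprime_of_le 𝔞.2.2.symm (Ideal.le_of_dvd hdvd)).symm

/-- The value `φ(Ψ(𝔞) mod U_N) ∈ ℂ` on an ideal prime to `𝔪_N`. [folklore] -/
def HasInfinityType.dualValue (φ : hinf.lAdicRaySubgroup hmod ι N →* ℂˣ)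
    (𝔞 : LFunctions.CoprimeIdeal (lModulus ℓ T e N)) : ℂ :=
  (φ (hinf.lAdicRayClass hmod ι N 𝔞) : ℂ)

/-- `dualValue` is multiplicative. [folklore] -/
theorem HasInfinityType.dualValue_mul (φ : hinf.lAdicRaySubgroup hmod ι N →* ℂˣ)
    (𝔞 𝔟 : LFunctions.CoprimeIdeal (lModulus ℓ T e N)) :
    hinf.dualValue hmod ι N φ ⟨𝔞.1 * 𝔟.1, 𝔞.mul_mem 𝔟⟩ = hinf.dualValue hmod ι N φ 𝔞 * hinf.dualValue hmod ι N φ 𝔟 := by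
  simp only [HasInfinityType.dualValue]
  rw [hinf.lAdicRayClass_mul hmod ι N 𝔞 𝔟, map_mul, Units.val_mul]

/-- `dualValue` of the unit ideal is `1`. [folklore] -/
theorem HasInfinityType.dualValue_eq_one_of_eq_top (φ : hinf.lAdicRaySubgroup hmod ι N →* ℂˣ)
    (𝔞 : LFunctions.CoprimeIdeal (lModulus ℓ T e N)) (h : 𝔞.1 = ⊤) : hinf.dualValue hmod ι N φ 𝔞 = 1 := by
  have h1 : hinf.lAdicRayClass hmod ι N 𝔞 = 1 := by
    apply Subtype.ext
    rw [HasInfinityType.coe_lAdicRayClass, Subgroup.coe_one, h, lAdicIdealPow_top, QuotientGroup.mk_one]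
  simp only [HasInfinityType.dualValue]
  rw [h1, map_one, Units.val_one]

/-- `dualValue` only depends on the underlying ideal. [folklore] -/
theorem HasInfinityType.dualValue_congr (φ : hinf.lAdicRaySubgroup hmod ι N →* ℂˣ)
    {𝔞 𝔟 : LFunctions.CoprimeIdeal (lModulus ℓ T e N)} (h : 𝔞.1 = 𝔟.1) :
    hinf.dualValue hmod ι N φ 𝔞 = hinf.dualValue hmod ι N φ 𝔟 := by
  rw [Subtype.ext h]

/-- `dualValue` on powers. [folklore] -/
theorem HasInfinityType.dualValue_pow (φ : hinf.lAdicRaySubgroup hmod ι N →* ℂˣ)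
    (𝔞 : LFunctions.CoprimeIdeal (lModulus ℓ T e N)) (k : ℕ) :
    hinf.dualValue hmod ι N φ ⟨𝔞.1 ^ k, 𝔞.pow_mem k⟩ = hinf.dualValue hmod ι N φ 𝔞 ^ k := by
  induction k with
  | zero =>
    rw [pow_zero (hinf.dualValue hmod ι N φ 𝔞)]
    exact hinf.dualValue_eq_one_of_eq_top hmod ι N φ _ ((pow_zero _).trans Ideal.one_eq_top)
  | succ k ih =>
    rw [pow_succ (hinf.dualValue hmod ι N φ 𝔞), ← ih,
      ← hinf.dualValue_mul hmod ι N φ ⟨𝔞.1 ^ k, 𝔞.pow_mem k⟩ 𝔞]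
    exact hinf.dualValue_congr hmod ι N φ (pow_succ _ _)

/-- At a prime `v ∤ 𝔪_N`, `charOfDual φ v = dualValue φ 𝔭_v`. [folklore] -/
theorem HasInfinityType.charOfDual_eq_dualValue (φ : hinf.lAdicRaySubgroup hmod ι N →* ℂˣ)
    {v : HeightOneSpectrum (𝓞 K)} (hv : IsCoprime v.asIdeal (lModulus ℓ T e N)) :
    hinf.charOfDual hmod ι N φ v = hinf.dualValue hmod ι N φ ⟨v.asIdeal, v.ne_bot, hv⟩ := by
  rw [hinf.charOfDual_apply_of_isCoprime hmod ι N φ hv]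
  rfl

omit [NumberField K] [Fact ℓ.Prime] in
/-- A finite product of prime powers at primes prime to `𝔪` is nonzero and prime to `𝔪`. [folklore] -/
theorem _root_.Literature.NumberTheory.LFunctions.CoprimeIdeal.finsetProd_pow_mem {𝔪 : Ideal (𝓞 K)}
    (S : Finset (HeightOneSpectrum (𝓞 K))) (k : HeightOneSpectrum (𝓞 K) → ℕ)
    (hS : ∀ v ∈ S, IsCoprime v.asIdeal 𝔪) :
    (∏ v ∈ S, v.asIdeal ^ k v) ≠ ⊥ ∧ IsCoprime (∏ v ∈ S, v.asIdeal ^ k v) 𝔪 := by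
  classical
  refine ⟨Finset.prod_ne_zero_iff.mpr fun v _ => pow_ne_zero _ v.ne_bot, ?_⟩
  exact IsCoprime.prod_left fun v hv => (hS v hv).pow_left

/-- **Multiplicativity of `dualValue` over a prime-power factorisation.** [folklore] -/
theorem HasInfinityType.dualValue_finsetProd (φ : hinf.lAdicRaySubgroup hmod ι N →* ℂˣ)
    (S : Finset (HeightOneSpectrum (𝓞 K))) (k : HeightOneSpectrum (𝓞 K) → ℕ)
    (hS : ∀ v ∈ S, IsCoprime v.asIdeal (lModulus ℓ T e N)) :
    hinf.dualValue hmod ι N φ ⟨∏ v ∈ S, v.asIdeal ^ k v, LFunctions.CoprimeIdeal.finsetProd_pow_mem S k hS⟩ =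
      ∏ v ∈ S, (if hv : IsCoprime v.asIdeal (lModulus ℓ T e N) then
        hinf.dualValue hmod ι N φ ⟨v.asIdeal, v.ne_bot, hv⟩ else 0) ^ k v := by
  classical
  induction S using Finset.induction_on with
  | empty =>
    conv_rhs => rw [Finset.prod_empty]
    exact hinf.dualValue_eq_one_of_eq_top hmod ι N φ _
      ((Finset.prod_empty (f := fun v : HeightOneSpectrum (𝓞 K) => v.asIdeal ^ k v)).trans Ideal.one_eq_top)
  | insert v S hvS ih =>
    have hS' : ∀ w ∈ S, IsCoprime w.asIdeal (lModulus ℓ T e N) := fun w hw => hS w (Finset.mem_insert_of_mem hw)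
    have hv : IsCoprime v.asIdeal (lModulus ℓ T e N) := hS v (Finset.mem_insert_self v S)
    conv_rhs => rw [Finset.prod_insert hvS, dif_pos hv]
    rw [← ih hS', ← hinf.dualValue_pow hmod ι N φ ⟨v.asIdeal, v.ne_bot, hv⟩ (k v),
      ← hinf.dualValue_mul hmod ι N φ]
    exact hinf.dualValue_congr hmod ι N φ (Finset.prod_insert hvS)

/-- **`χ_φ(𝔞) = φ(Ψ(𝔞) mod U_N)`**: the ideal-theoretic extension of `charOfDual φ` (`idealPow`) on an
ideal `𝔞` prime to `𝔪_N` is `φ` of the class of `Ψ(𝔞)` (unique factorisation and multiplicativity).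
[folklore] -/
theorem HasInfinityType.idealPow_charOfDual (φ : hinf.lAdicRaySubgroup hmod ι N →* ℂˣ)
    (𝔞 : LFunctions.CoprimeIdeal (lModulus ℓ T e N)) :
    LFunctions.idealPow K (hinf.charOfDual hmod ι N φ) 𝔞.1 = hinf.dualValue hmod ι N φ 𝔞 := by
  classical
  have hcount : ∀ v : HeightOneSpectrum (𝓞 K),
      (Associates.mk v.asIdeal).count (Associates.mk 𝔞.1).factors ≠ 0 → IsCoprime v.asIdeal (lModulus ℓ T e N) :=
    fun v => 𝔞.isCoprime_of_count_ne_zero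
  -- the finite set of primes dividing `𝔞`
  have hfin : {v : HeightOneSpectrum (𝓞 K) | (Associates.mk v.asIdeal).count (Associates.mk 𝔞.1).factors ≠ 0}.Finite := by
    refine (Filter.eventually_cofinite.mp (Associates.finite_factors 𝔞.2.1)).subset fun v hv => ?_
    intro h0
    have h0' : (Associates.mk v.asIdeal).count (Associates.mk 𝔞.1).factors = 0 := by exact_mod_cast h0
    exact hv h0'
  set S : Finset (HeightOneSpectrum (𝓞 K)) := hfin.toFinset with hS
  have hSmem : ∀ v, v ∈ S ↔ (Associates.mk v.asIdeal).count (Associates.mk 𝔞.1).factors ≠ 0 := fun v => by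
    rw [hS, Set.Finite.mem_toFinset, Set.mem_setOf_eq]
  have hScop : ∀ v ∈ S, IsCoprime v.asIdeal (lModulus ℓ T e N) := fun v hv => hcount v ((hSmem v).mp hv)
  -- unique factorisation: `𝔞 = ∏_{v ∈ S} 𝔭_v^{n_v}`
  have hfact : (∏ v ∈ S, v.asIdeal ^ (Associates.mk v.asIdeal).count (Associates.mk 𝔞.1).factors) = 𝔞.1 := by
    rw [← finprod_eq_prod_of_mulSupport_subset
      (fun v : HeightOneSpectrum (𝓞 K) => v.asIdeal ^ (Associates.mk v.asIdeal).count (Associates.mk 𝔞.1).factors)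
      (s := S) ?_]
    · exact Ideal.finprod_heightOneSpectrum_factorization 𝔞.2.1
    · intro v hv
      rw [Function.mem_mulSupport] at hv
      rw [Finset.mem_coe, hSmem]
      intro h0
      exact hv (by rw [h0, pow_zero])
  have h𝔞 : 𝔞 = ⟨∏ v ∈ S, v.asIdeal ^ (Associates.mk v.asIdeal).count (Associates.mk 𝔞.1).factors,
      LFunctions.CoprimeIdeal.finsetProd_pow_mem S _ hScop⟩ := Subtype.ext hfact.symm
  -- both sides are the product of the local values
  rw [LFunctions.idealPow, finprod_eq_prod_of_mulSupport_subset _ (s := S) ?_]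
  · conv_rhs => rw [h𝔞, hinf.dualValue_finsetProd hmod ι N φ S _ hScop]
    refine Finset.prod_congr rfl fun v hv => ?_
    rw [dif_pos (hScop v hv), hinf.charOfDual_eq_dualValue hmod ι N φ (hScop v hv)]
  · intro v hv
    rw [Function.mem_mulSupport] at hv
    rw [Finset.mem_coe, hSmem]
    intro h0
    exact hv (by rw [h0, pow_zero])

omit [NumberField K] in
/-- `IsCoprime v 𝔪 ⟹ ¬ 𝔪 ≤ v`. [folklore] -/
theorem _root_.IsDedekindDomain.HeightOneSpectrum.not_le_of_isCoprime {𝔪 : Ideal (𝓞 K)}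
    (v : HeightOneSpectrum (𝓞 K)) (hv : IsCoprime v.asIdeal 𝔪) : ¬ 𝔪 ≤ v.asIdeal := by
  intro hle
  rw [Ideal.isCoprime_iff_sup_eq, sup_eq_left.mpr hle] at hv
  exact v.isPrime.ne_top hv

/-- **`charOfDual φ` is a ray class character modulo `𝔪_N`** (`IsRayClassCharacter`): values of norm
one (the finite group `H_N`), trivial on the ray (the congruence `mk_lAdicIdealPow_span_eq`).
Ref: Weil 1956 §2 (the `λ`-adic character modulo `λ^N` is a character of a ray class group);
Neukirch VII (6.8). [cite: Weil1956, §2] [cite: NeukirchANT1999, Ch. VII §6 Def. (6.8)] -/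
theorem HasInfinityType.isRayClassCharacter_charOfDual (φ : hinf.lAdicRaySubgroup hmod ι N →* ℂˣ) :
    LFunctions.IsRayClassCharacter (lModulus ℓ T e N) (hinf.charOfDual hmod ι N φ) := by
  haveI := hinf.finite_lAdicRaySubgroup hmod ι N
  refine ⟨fun v hv => ?_, fun b c hb hc hcop hbc hpos => ?_⟩
  · have hcop : IsCoprime v.asIdeal (lModulus ℓ T e N) := v.isCoprime_of_not_le hv
    rw [hinf.charOfDual_apply_of_isCoprime hmod ι N φ hcop]
    have hfin : IsOfFinOrder (φ (hinf.lAdicRayClassAt hmod ι N v hcop)) :=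
      φ.isOfFinOrder (isOfFinOrder_of_finite _)
    obtain ⟨m, hm, hm1⟩ := hfin.exists_pow_eq_one
    exact Complex.norm_eq_one_of_pow_eq_one (by rw [← Units.val_pow_eq_pow_val, hm1, Units.val_one]) hm.ne'
  · have hbcop : IsCoprime (Ideal.span {b}) (lModulus ℓ T e N) := LFunctions.isCoprime_span_of_sub_mem hcop hbc
    have hb0 : (Ideal.span {b} : Ideal (𝓞 K)) ≠ ⊥ := by rwa [Ne, Ideal.span_singleton_eq_bot]
    have hc0 : (Ideal.span {c} : Ideal (𝓞 K)) ≠ ⊥ := by rwa [Ne, Ideal.span_singleton_eq_bot]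
    rw [hinf.idealPow_charOfDual hmod ι N φ ⟨Ideal.span {b}, hb0, hbcop⟩,
      hinf.idealPow_charOfDual hmod ι N φ ⟨Ideal.span {c}, hc0, hcop⟩]
    simp only [HasInfinityType.dualValue]
    congr 2
    apply Subtype.ext
    simp only [HasInfinityType.coe_lAdicRayClass]
    exact hinf.mk_lAdicIdealPow_span_eq hmod ι hb hc hcop hbc hpos

/-- **The Artin character of a character `φ` of `H_N`.**  There is a rank-one Artin representation
`ρ_φ : Γ_K → GL_1(ℂ)`, unramified at every place `v` prime to `𝔪_N`, whose arithmetic Frobenii there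
have the value `φ(Ψ(𝔭_v) mod U_N)` — the ray class character `charOfDual φ` is a finite-order
Hecke character (`HeckeCharacter.exists_of_isRayClassCharacter`, Neukirch VII (6.9), (6.14)), which is
the Hecke character of a rank-one Artin representation with the same ramification (class field
theory, `HeckeCharacter.exists_framedArtinRep_of_isFiniteOrder`).
[cite: CasselsFrohlichANT1967, Ch. VII §5.1 Main Theorem] [cite: NeukirchANT1999, Ch. VII §6 Cor. (6.14)] -/
theorem HasInfinityType.exists_artinRep_of_dual (φ : hinf.lAdicRaySubgroup hmod ι N →* ℂˣ) :
    ∃ ρ : FramedArtinRep K 1, ∀ (v : HeightOneSpectrum (𝓞 K)) (hv : IsCoprime v.asIdeal (lModulus ℓ T e N)),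
      ρ.IsUnramifiedAt v ∧ ∀ 𝔓 ∈ v.primesAbove, ∀ Φ : absoluteGaloisGroup K, IsArithFrobAt (𝓞 K) Φ 𝔓 →
        ((ρ Φ : GL (Fin 1) ℂ) : Matrix (Fin 1) (Fin 1) ℂ) 0 0 = (φ (hinf.lAdicRayClassAt hmod ι N v hv) : ℂ) := by
  obtain ⟨ω, hωfin, hω⟩ := exists_of_isRayClassCharacter (lModulus_ne_bot T e N)
    (hinf.isRayClassCharacter_charOfDual hmod ι N φ)
  obtain ⟨ρ, hram, hfrob⟩ := ω.exists_framedArtinRep_of_isFiniteOrder hωfin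
  refine ⟨ρ, fun v hv => ?_⟩
  have hv' := v.not_le_of_isCoprime hv
  have hωv := hω v hv'
  refine ⟨(hram v).mpr hωv.1, fun 𝔓 h𝔓 Φ hΦ => ?_⟩
  have h := (FramedGaloisRep.hasFrobCharpolyAt_iff_of_rank_one ρ v _).mp (hfrob v hωv.1) 𝔓 h𝔓 Φ hΦ
  rw [h, hωv.2, hinf.charOfDual_apply_of_isCoprime hmod ι N φ hv]

end Dual

/-! ### §7. The level-`N` character `R_N : Γ_K → H_N` (duality and Frobenius density) -/

section Assembly

variable {p q : InfinitePlace K → ℤ} (hinf : χ.HasInfinityType p q) (hmod : IsModulus χ T e)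
  (ι : PadicAlgCl ℓ ≃+* ℂ) (N : ℕ)

/-- `ℂ` has enough roots of unity of order the exponent of the finite group `H_N`. [folklore] -/
theorem HasInfinityType.hasEnoughRootsOfUnity_exponent :
    HasEnoughRootsOfUnity ℂ (Monoid.exponent (hinf.lAdicRaySubgroup hmod ι N)) := by
  haveI := hinf.finite_lAdicRaySubgroup hmod ι N
  haveI : NeZero ((Monoid.exponent (hinf.lAdicRaySubgroup hmod ι N) : ℕ) : ℂ) :=
    ⟨Nat.cast_ne_zero.mpr Monoid.exponent_ne_zero_of_finite⟩
  infer_instance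

/-- **The characters of the finite abelian group `H_N` separate points.** [folklore] -/
theorem HasInfinityType.eq_one_of_forall_dual_eq_one {h : hinf.lAdicRaySubgroup hmod ι N}
    (hh : ∀ φ : hinf.lAdicRaySubgroup hmod ι N →* ℂˣ, φ h = 1) : h = 1 := by
  haveI := hinf.finite_lAdicRaySubgroup hmod ι N
  haveI := hinf.hasEnoughRootsOfUnity_exponent hmod ι N
  by_contra hne
  obtain ⟨φ, hφ⟩ := CommGroup.exists_apply_ne_one_of_hasEnoughRootsOfUnity (hinf.lAdicRaySubgroup hmod ι N) ℂ hne
  exact hφ (hh φ)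

/-- The dual group of `H_N` is finite. [folklore] -/
theorem HasInfinityType.finite_dual : Finite (hinf.lAdicRaySubgroup hmod ι N →* ℂˣ) := by
  haveI := hinf.finite_lAdicRaySubgroup hmod ι N
  haveI := hinf.hasEnoughRootsOfUnity_exponent hmod ι N
  obtain ⟨e⟩ := CommGroup.monoidHom_mulEquiv_of_hasEnoughRootsOfUnity (hinf.lAdicRaySubgroup hmod ι N) ℂ
  exact Finite.of_equiv _ e.symm.toEquiv

/-- The **evaluation embedding** `H_N ↪ ((H_N →* ℂˣ) → ℂˣ)`, `h ↦ (φ ↦ φ h)`. [folklore] -/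
def HasInfinityType.evalHom : hinf.lAdicRaySubgroup hmod ι N →* ((hinf.lAdicRaySubgroup hmod ι N →* ℂˣ) → ℂˣ) where
  toFun h φ := φ h
  map_one' := funext fun φ => map_one φ
  map_mul' a b := funext fun φ => map_mul φ a b

/-- Unfolding lemma for `evalHom`. [folklore] -/
@[simp] theorem HasInfinityType.evalHom_apply (h : hinf.lAdicRaySubgroup hmod ι N)
    (φ : hinf.lAdicRaySubgroup hmod ι N →* ℂˣ) : hinf.evalHom hmod ι N h φ = φ h :=
  rfl

/-- `evalHom` is injective (duality). [folklore] -/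
theorem HasInfinityType.evalHom_injective : Function.Injective (hinf.evalHom hmod ι N) := by
  rw [injective_iff_map_eq_one]
  intro h hh
  exact hinf.eq_one_of_forall_dual_eq_one hmod ι N fun φ => by rw [← hinf.evalHom_apply hmod ι N h φ, hh]; rfl

/-- **The Artin character `ρ_φ` of a character `φ` of `H_N`** (a choice in `exists_artinRep_of_dual`).
[cite: CasselsFrohlichANT1967, Ch. VII §5.1 Main Theorem] -/
def HasInfinityType.artinOfDual (φ : hinf.lAdicRaySubgroup hmod ι N →* ℂˣ) : FramedArtinRep K 1 :=
  (hinf.exists_artinRep_of_dual hmod ι N φ).choose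

/-- Defining property of `artinOfDual`: unramified at the places prime to `𝔪_N`, with Frobenius value
`φ(Ψ(𝔭_v) mod U_N)`. [folklore] -/
theorem HasInfinityType.artinOfDual_spec (φ : hinf.lAdicRaySubgroup hmod ι N →* ℂˣ)
    (v : HeightOneSpectrum (𝓞 K)) (hv : IsCoprime v.asIdeal (lModulus ℓ T e N)) :
    (hinf.artinOfDual hmod ι N φ).IsUnramifiedAt v ∧ ∀ 𝔓 ∈ v.primesAbove, ∀ Φ : absoluteGaloisGroup K,
      IsArithFrobAt (𝓞 K) Φ 𝔓 →
        ((hinf.artinOfDual hmod ι N φ Φ : GL (Fin 1) ℂ) : Matrix (Fin 1) (Fin 1) ℂ) 0 0 =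
          (φ (hinf.lAdicRayClassAt hmod ι N v hv) : ℂ) :=
  (hinf.exists_artinRep_of_dual hmod ι N φ).choose_spec v hv

/-- **The family of Artin characters as one homomorphism** `σ ↦ (φ ↦ det ρ_φ(σ))`. [folklore] -/
def HasInfinityType.dualFamilyHom : absoluteGaloisGroup K →* ((hinf.lAdicRaySubgroup hmod ι N →* ℂˣ) → ℂˣ) where
  toFun σ φ := FramedRep.det (hinf.artinOfDual hmod ι N φ) σ
  map_one' := funext fun _ => map_one _
  map_mul' σ τ := funext fun _ => map_mul _ σ τ

/-- Unfolding lemma for `dualFamilyHom`. [folklore] -/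
@[simp] theorem HasInfinityType.dualFamilyHom_apply (σ : absoluteGaloisGroup K)
    (φ : hinf.lAdicRaySubgroup hmod ι N →* ℂˣ) :
    hinf.dualFamilyHom hmod ι N σ φ = FramedRep.det (hinf.artinOfDual hmod ι N φ) σ :=
  rfl

/-- The kernel of `dualFamilyHom` is open (a finite intersection of open kernels of Artin characters).
[folklore] -/
theorem HasInfinityType.isOpen_ker_dualFamilyHom :
    IsOpen ((hinf.dualFamilyHom hmod ι N).ker : Set (absoluteGaloisGroup K)) := by
  haveI := hinf.finite_dual hmod ι N
  have heq : ((hinf.dualFamilyHom hmod ι N).ker : Set (absoluteGaloisGroup K)) =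
      ⋂ φ : hinf.lAdicRaySubgroup hmod ι N →* ℂˣ,
        {σ | FramedRep.det (hinf.artinOfDual hmod ι N φ) σ = 1} := by
    ext σ
    simp only [SetLike.mem_coe, MonoidHom.mem_ker, Set.mem_iInter, Set.mem_setOf_eq]
    constructor
    · intro h φ
      have := congrFun h φ
      rwa [hinf.dualFamilyHom_apply hmod ι N] at this
    · intro h
      funext φ
      exact h φ
  rw [heq]
  refine isOpen_iInter_of_finite fun φ => ?_
  -- the set is the open subgroup `ker (det ρ_φ) ⊇ ker ρ_φ`
  have : {σ : absoluteGaloisGroup K | FramedRep.det (hinf.artinOfDual hmod ι N φ) σ = 1} =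
      ((FramedRep.det (hinf.artinOfDual hmod ι N φ)).toMonoidHom.ker : Set (absoluteGaloisGroup K)) := by
    ext σ; simp [MonoidHom.mem_ker]
  rw [this]
  refine Subgroup.isOpen_mono (fun σ hσ => ?_) (hinf.artinOfDual hmod ι N φ).isOpen_ker_toMonoidHom
  rw [MonoidHom.mem_ker] at hσ ⊢
  change FramedRep.det (hinf.artinOfDual hmod ι N φ) σ = 1
  change hinf.artinOfDual hmod ι N φ σ = 1 at hσ
  rw [FramedRep.det_apply, hσ, map_one]

/-- At a Frobenius above a place prime to `𝔪_N`, `dualFamilyHom` takes the value `ev(Ψ(𝔭_v) mod U_N)`.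
[folklore] -/
theorem HasInfinityType.dualFamilyHom_frob {v : HeightOneSpectrum (𝓞 K)} (hv : IsCoprime v.asIdeal (lModulus ℓ T e N))
    {𝔓 : Ideal (absIntegers (𝓞 K) K)} (h𝔓 : 𝔓 ∈ v.primesAbove) {Φ : absoluteGaloisGroup K}
    (hΦ : IsArithFrobAt (𝓞 K) Φ 𝔓) :
    hinf.dualFamilyHom hmod ι N Φ = hinf.evalHom hmod ι N (hinf.lAdicRayClassAt hmod ι N v hv) := by
  funext φ
  rw [hinf.dualFamilyHom_apply hmod ι N, hinf.evalHom_apply hmod ι N]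
  apply Units.ext
  rw [FramedRep.det_apply, Matrix.GeneralLinearGroup.val_det_apply, Matrix.det_fin_one]
  exact (hinf.artinOfDual_spec hmod ι N φ v hv).2 𝔓 h𝔓 Φ hΦ

/-- **The values of `dualFamilyHom` lie in the image of `H_N`** (Frobenius density: the preimage of
`ev(H_N)` is an open, hence closed, subgroup of `Γ_K` containing every Frobenius above the places prime
to `𝔪_N`).  Ref: Chebotarev/Frobenius density (tree `absoluteGaloisGroup.subgroup_eq_top_of_isClosed_of_frobenius_mem`).
[folklore] -/
theorem HasInfinityType.dualFamilyHom_mem_range (σ : absoluteGaloisGroup K) :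
    hinf.dualFamilyHom hmod ι N σ ∈ (hinf.evalHom hmod ι N).range := by
  set H : Subgroup (absoluteGaloisGroup K) := ((hinf.evalHom hmod ι N).range).comap (hinf.dualFamilyHom hmod ι N)
    with hH
  have hker : (hinf.dualFamilyHom hmod ι N).ker ≤ H := fun τ hτ => by
    rw [hH, Subgroup.mem_comap, (MonoidHom.mem_ker).mp hτ]
    exact one_mem _
  have hopen : IsOpen (H : Set (absoluteGaloisGroup K)) :=
    Subgroup.isOpen_mono hker (hinf.isOpen_ker_dualFamilyHom hmod ι N)
  have hclosed : IsClosed (H : Set (absoluteGaloisGroup K)) := Subgroup.isClosed_of_isOpen H hopen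
  have htop : H = ⊤ :=
    absoluteGaloisGroup.subgroup_eq_top_of_isClosed_of_frobenius_mem (finite_setOf_lModulus_le T e N (ℓ := ℓ))
      hclosed fun v hv 𝔓 h𝔓 Φ hΦ => by
        rw [hH, Subgroup.mem_comap, hinf.dualFamilyHom_frob hmod ι N (v.isCoprime_of_not_le hv) h𝔓 hΦ]
        exact ⟨_, rfl⟩
  have : σ ∈ H := htop ▸ Subgroup.mem_top σ
  rw [hH, Subgroup.mem_comap] at this
  exact this

/-- **The level-`N` character `R_N : Γ_K → H_N`**: `σ ↦ ev⁻¹((det ρ_φ(σ))_φ)`.  Ref: Weil 1956 §2 /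
Serre 1968 Ch. II §2.8 (the `λ`-adic character modulo `λ^N` is a character of a ray class group, hence of
`Γ_K` by class field theory). [cite: Weil1956, §2] [cite: SerreAbelianLadic1968, Ch. II §2.8] -/
def HasInfinityType.levelChar : absoluteGaloisGroup K →* hinf.lAdicRaySubgroup hmod ι N :=
  (MonoidHom.ofInjective (hinf.evalHom_injective hmod ι N)).symm.toMonoidHom.comp
    ((hinf.dualFamilyHom hmod ι N).codRestrict (hinf.evalHom hmod ι N).range
      (hinf.dualFamilyHom_mem_range hmod ι N))

/-- `ev ∘ R_N = dualFamilyHom`. [folklore] -/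
theorem HasInfinityType.evalHom_levelChar (σ : absoluteGaloisGroup K) :
    hinf.evalHom hmod ι N (hinf.levelChar hmod ι N σ) = hinf.dualFamilyHom hmod ι N σ := by
  rw [HasInfinityType.levelChar, MonoidHom.comp_apply, MulEquiv.coe_toMonoidHom, MonoidHom.apply_ofInjective_symm]
  rfl

/-- **Frobenius values of `R_N`**: `R_N(Φ) = Ψ(𝔭_v) mod U_N` for an arithmetic Frobenius `Φ` above a
place `v` prime to `𝔪_N`. [folklore] -/
theorem HasInfinityType.levelChar_frob {v : HeightOneSpectrum (𝓞 K)} (hv : IsCoprime v.asIdeal (lModulus ℓ T e N))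
    {𝔓 : Ideal (absIntegers (𝓞 K) K)} (h𝔓 : 𝔓 ∈ v.primesAbove) {Φ : absoluteGaloisGroup K}
    (hΦ : IsArithFrobAt (𝓞 K) Φ 𝔓) :
    hinf.levelChar hmod ι N Φ = hinf.lAdicRayClassAt hmod ι N v hv :=
  hinf.evalHom_injective hmod ι N (by rw [hinf.evalHom_levelChar hmod ι N, hinf.dualFamilyHom_frob hmod ι N hv h𝔓 hΦ])

/-- `R_N σ = 1 ↔ dualFamilyHom σ = 1`. [folklore] -/
theorem HasInfinityType.levelChar_eq_one_iff (σ : absoluteGaloisGroup K) :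
    hinf.levelChar hmod ι N σ = 1 ↔ hinf.dualFamilyHom hmod ι N σ = 1 := by
  rw [← (hinf.evalHom_injective hmod ι N).eq_iff, hinf.evalHom_levelChar hmod ι N, map_one]

/-- **The kernel of `R_N` is open** (so `R_N` is continuous for the discrete topology on `H_N`). [folklore] -/
theorem HasInfinityType.isOpen_ker_levelChar :
    IsOpen ((hinf.levelChar hmod ι N).ker : Set (absoluteGaloisGroup K)) := by
  have : ((hinf.levelChar hmod ι N).ker : Set (absoluteGaloisGroup K)) = (hinf.dualFamilyHom hmod ι N).ker := by
    ext σ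
    simp only [SetLike.mem_coe, MonoidHom.mem_ker]
    exact hinf.levelChar_eq_one_iff hmod ι N σ
  rw [this]
  exact hinf.isOpen_ker_dualFamilyHom hmod ι N

/-- **`R_N` kills the inertia groups above the places prime to `𝔪_N`** (every `ρ_φ` is unramified
there). [folklore] -/
theorem HasInfinityType.levelChar_eq_one_of_mem_inertia {v : HeightOneSpectrum (𝓞 K)}
    (hv : IsCoprime v.asIdeal (lModulus ℓ T e N)) {𝔓 : Ideal (absIntegers (𝓞 K) K)} (h𝔓 : 𝔓 ∈ v.primesAbove)
    {σ : absoluteGaloisGroup K} (hσ : σ ∈ 𝔓.inertia (absoluteGaloisGroup K)) :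
    hinf.levelChar hmod ι N σ = 1 := by
  rw [hinf.levelChar_eq_one_iff hmod ι N]
  funext φ
  rw [hinf.dualFamilyHom_apply hmod ι N, FramedRep.det_apply, (hinf.artinOfDual_spec hmod ι N φ v hv).1 𝔓 h𝔓 σ hσ,
    map_one]
  rfl

/-! #### Compatibility of the levels -/

/-- **The level-`M` and level-`N` characters are compatible** (`N ≤ M`): the class of `R_M(σ)` in
`ℚ̄_ℓˣ/U_N` is `R_N(σ)` — both sides are homomorphisms `Γ_K → ℚ̄_ℓˣ/U_N` with open kernels agreeing at
the Frobenii (Frobenius density). [folklore] -/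
theorem HasInfinityType.map_levelChar_eq {M : ℕ} (hNM : N ≤ M) (σ : absoluteGaloisGroup K) :
    QuotientGroup.map (lOneUnits ℓ M) (lOneUnits ℓ N) (MonoidHom.id _) (lOneUnits_antitone hNM)
        ((hinf.levelChar hmod ι M σ : hinf.lAdicRaySubgroup hmod ι M) : (PadicAlgCl ℓ)ˣ ⧸ lOneUnits ℓ M) =
      ((hinf.levelChar hmod ι N σ : hinf.lAdicRaySubgroup hmod ι N) : (PadicAlgCl ℓ)ˣ ⧸ lOneUnits ℓ N) := by
  set f : absoluteGaloisGroup K →* (PadicAlgCl ℓ)ˣ ⧸ lOneUnits ℓ N :=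
    (QuotientGroup.map (lOneUnits ℓ M) (lOneUnits ℓ N) (MonoidHom.id _) (lOneUnits_antitone hNM)).comp
      ((hinf.lAdicRaySubgroup hmod ι M).subtype.comp (hinf.levelChar hmod ι M)) with hf
  set g : absoluteGaloisGroup K →* (PadicAlgCl ℓ)ˣ ⧸ lOneUnits ℓ N :=
    (hinf.lAdicRaySubgroup hmod ι N).subtype.comp (hinf.levelChar hmod ι N) with hg
  have hker : (hinf.levelChar hmod ι M).ker ⊓ (hinf.levelChar hmod ι N).ker ≤ f.eqLocus g := by
    intro τ hτ
    obtain ⟨h1, h2⟩ := Subgroup.mem_inf.mp hτ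
    rw [MonoidHom.mem_ker] at h1 h2
    show f τ = g τ
    simp only [hf, hg, MonoidHom.comp_apply, h1, h2, map_one]
  have hopen : IsOpen ((f.eqLocus g : Subgroup (absoluteGaloisGroup K)) : Set (absoluteGaloisGroup K)) :=
    Subgroup.isOpen_mono hker ((hinf.isOpen_ker_levelChar hmod ι M).inter (hinf.isOpen_ker_levelChar hmod ι N))
  have hclosed := Subgroup.isClosed_of_isOpen _ hopen
  have htop : f.eqLocus g = ⊤ :=
    absoluteGaloisGroup.subgroup_eq_top_of_isClosed_of_frobenius_mem (finite_setOf_lModulus_le T e M (ℓ := ℓ))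
      hclosed fun v hv 𝔓 h𝔓 Φ hΦ => by
        have hvM : IsCoprime v.asIdeal (lModulus ℓ T e M) := v.isCoprime_of_not_le hv
        have hvN : IsCoprime v.asIdeal (lModulus ℓ T e N) := Ideal.isCoprime_of_le hvM (lModulus_antitone T e hNM)
        show f Φ = g Φ
        simp only [hf, hg, MonoidHom.comp_apply, Subgroup.coe_subtype,
          hinf.levelChar_frob hmod ι M hvM h𝔓 hΦ, hinf.levelChar_frob hmod ι N hvN h𝔓 hΦ,
          HasInfinityType.coe_lAdicRayClassAt, QuotientGroup.map_mk, MonoidHom.id_apply]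
  have hσ : σ ∈ f.eqLocus g := htop ▸ Subgroup.mem_top σ
  exact hσ

end Assembly

/-! ### §8. The values lie in a finite extension of `ℚ_ℓ`; passage to the limit -/

section ValueField

open scoped IntermediateField

variable (K) in
/-- A primitive element of `K/ℚ` (a choice). [folklore] -/
def primitiveElt : K := (Field.exists_primitive_element ℚ K).choose

omit [Fact ℓ.Prime] in
/-- `ℚ⟮θ⟯ = K`. [folklore] -/
theorem adjoin_primitiveElt : ℚ⟮primitiveElt K⟯ = ⊤ := (Field.exists_primitive_element ℚ K).choose_spec

variable (χ ι T e)

/-- The finite generating set: the conjugates `ι⁻¹(σ_w(θ))`, `ι⁻¹(\overline{σ_w}(θ))` of a primitive element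
and the values `Ψ(𝔞_i)` at representatives of the narrow ray classes modulo `𝔪_0`. [folklore] -/
def lAdicValueGens : Set (PadicAlgCl ℓ) :=
  (Set.range fun w : InfinitePlace K => (ι.symm : ℂ →+* PadicAlgCl ℓ) (w.embedding (primitiveElt K))) ∪
  (Set.range fun w : InfinitePlace K => (ι.symm : ℂ →+* PadicAlgCl ℓ) (conj (w.embedding (primitiveElt K)))) ∪
  (Set.range fun c : Quotient (LFunctions.rayClassSetoid (lModulus ℓ T e 0)) => (χ.lAdicIdealPow ι c.out.1 : PadicAlgCl ℓ))

/-- The generating set is finite. [folklore] -/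
theorem finite_lAdicValueGens : (lAdicValueGens χ ι T e).Finite := by
  haveI := LFunctions.finite_rayClassQuotient (lModulus_ne_bot T e 0 (ℓ := ℓ))
  exact ((Set.finite_range _).union (Set.finite_range _)).union (Set.finite_range _)

/-- **The field of values** `E = ℚ_ℓ(ι⁻¹σ_w(θ), ι⁻¹\overline{σ_w}(θ), Ψ(𝔞_i))`, a finite extension of `ℚ_ℓ`
inside `ℚ̄_ℓ` containing all the values `Ψ(𝔞)` (`lAdicIdealPow_mem_lAdicValueField`).  Ref: Weil 1956
§2 (the values of a character of type `A₀` generate a number field); Serre 1968 Ch. II §2.7.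
[cite: SerreAbelianLadic1968, Ch. II §2.7] -/
def lAdicValueField : IntermediateField ℚ_[ℓ] (PadicAlgCl ℓ) :=
  IntermediateField.adjoin ℚ_[ℓ] (lAdicValueGens χ ι T e)

/-- `E` is finite-dimensional over `ℚ_ℓ`. [folklore] -/
theorem finiteDimensional_lAdicValueField : FiniteDimensional ℚ_[ℓ] (lAdicValueField χ ι T e) := by
  haveI : Finite (lAdicValueGens χ ι T e) := (finite_lAdicValueGens χ ι T e).to_subtype
  exact IntermediateField.finiteDimensional_adjoin fun x _ =>
    (Algebra.IsAlgebraic.isAlgebraic (R := ℚ_[ℓ]) x).isIntegral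

/-- `E` is complete (a finite-dimensional subspace of `ℚ̄_ℓ` over the complete field `ℚ_ℓ`). [folklore] -/
theorem isComplete_lAdicValueField : IsComplete ((lAdicValueField χ ι T e : Set (PadicAlgCl ℓ))) := by
  haveI : FiniteDimensional ℚ_[ℓ] ((lAdicValueField χ ι T e).toSubalgebra.toSubmodule) :=
    finiteDimensional_lAdicValueField χ ι T e
  exact Submodule.complete_of_finiteDimensional ((lAdicValueField χ ι T e).toSubalgebra.toSubmodule)

/-- The image of `K` under an embedding `τ` with `τ(θ) ∈ E` lies in `E`. [folklore] -/
theorem embedding_mem_lAdicValueField (τ : K →+* PadicAlgCl ℓ)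
    (hτ : τ (primitiveElt K) ∈ lAdicValueField χ ι T e) (x : K) : τ x ∈ lAdicValueField χ ι T e := by
  have hx : x ∈ ℚ⟮primitiveElt K⟯ := by rw [adjoin_primitiveElt]; exact IntermediateField.mem_top
  obtain ⟨r, s', hrs⟩ := (IntermediateField.mem_adjoin_simple_iff (F := ℚ) x).mp hx
  have hC : ∀ a : ℚ, algebraMap ℚ (PadicAlgCl ℓ) a ∈ lAdicValueField χ ι T e := by
    intro a
    have : algebraMap ℚ (PadicAlgCl ℓ) a = algebraMap ℚ_[ℓ] (PadicAlgCl ℓ) (a : ℚ_[ℓ]) := by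
      rw [eq_ratCast, map_ratCast]
    rw [this]
    exact IntermediateField.algebraMap_mem _ _
  have hpoly : ∀ f : Polynomial ℚ, τ (Polynomial.aeval (primitiveElt K) f) ∈ lAdicValueField χ ι T e := by
    intro f
    rw [show τ (Polynomial.aeval (primitiveElt K) f) = Polynomial.aeval (τ (primitiveElt K)) f from
      (Polynomial.aeval_algHom_apply τ.toRatAlgHom (primitiveElt K) f).symm]
    induction f using Polynomial.induction_on with
    | C a => rw [Polynomial.aeval_C]; exact hC a
    | add f g hf hg => rw [map_add]; exact add_mem hf hg
    | monomial n a _ =>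
      rw [map_mul, Polynomial.aeval_C, map_pow, Polynomial.aeval_X]
      exact mul_mem (hC a) (pow_mem hτ _)
  rw [hrs, map_div₀]
  exact div_mem (hpoly r) (hpoly s')

/-- `ι⁻¹(σ_w(x)) ∈ E`. [folklore] -/
theorem ιsymm_embedding_mem_lAdicValueField (w : InfinitePlace K) (x : K) :
    (ι.symm : ℂ →+* PadicAlgCl ℓ) (w.embedding x) ∈ lAdicValueField χ ι T e :=
  embedding_mem_lAdicValueField χ ι T e ((ι.symm : ℂ →+* PadicAlgCl ℓ).comp w.embedding)
    (IntermediateField.subset_adjoin _ _ (Or.inl (Or.inl ⟨w, rfl⟩))) x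

/-- `ι⁻¹(\overline{σ_w}(x)) ∈ E`. [folklore] -/
theorem ιsymm_conj_embedding_mem_lAdicValueField (w : InfinitePlace K) (x : K) :
    (ι.symm : ℂ →+* PadicAlgCl ℓ) (conj (w.embedding x)) ∈ lAdicValueField χ ι T e := by
  have := embedding_mem_lAdicValueField χ ι T e
    ((ι.symm : ℂ →+* PadicAlgCl ℓ).comp (NumberField.ComplexEmbedding.conjugate w.embedding))
    (IntermediateField.subset_adjoin _ _ (Or.inl (Or.inr ⟨w, rfl⟩))) x
  simpa only [RingHom.comp_apply, NumberField.ComplexEmbedding.conjugate_coe_eq] using this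

/-- The `ℓ`-adic archimedean ratio lies in `E`. [folklore] -/
theorem ιsymm_archRatio_mem_lAdicValueField (p q : InfinitePlace K → ℤ) (b c : K) :
    ι.symm (∏ w : InfinitePlace K, w.embedding (b / c) ^ (p w) * conj (w.embedding (b / c)) ^ (q w)) ∈
      lAdicValueField χ ι T e := by
  rw [map_prod]
  refine prod_mem fun w _ => ?_
  rw [map_mul, map_zpow₀, map_zpow₀]
  exact mul_mem (zpow_mem (ιsymm_embedding_mem_lAdicValueField χ ι T e w _) _)
    (zpow_mem (ιsymm_conj_embedding_mem_lAdicValueField χ ι T e w _) _)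

variable {χ ι T e}

/-- **All values `Ψ(𝔞)`, `𝔞` prime to `𝔪`, lie in `E`.**  For `𝔞` in the narrow ray class of the
representative `𝔞_i` modulo `𝔪_0`, `(c) 𝔞_i = (b) 𝔞` and `Ψ((b))/Ψ((c)) = ι⁻¹(∏_w σ_w(b/c)^{p_w} ⋯)`
(`idealPow_span_eq`), so `Ψ(𝔞) = Ψ(𝔞_i) · ι⁻¹(⋯)⁻¹ ∈ E`.  Ref: Weil 1956 §2. [cite: Weil1956, §2] -/
theorem HasInfinityType.lAdicIdealPow_mem_lAdicValueField {p q : InfinitePlace K → ℤ} (hinf : χ.HasInfinityType p q)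
    (hmod : IsModulus χ T e) (ι : PadicAlgCl ℓ ≃+* ℂ) {N : ℕ} (𝔞 : LFunctions.CoprimeIdeal (lModulus ℓ T e N)) :
    (χ.lAdicIdealPow ι 𝔞.1 : PadicAlgCl ℓ) ∈ lAdicValueField χ ι T e := by
  -- reduce to level `0`
  have h𝔞0 : IsCoprime 𝔞.1 (lModulus ℓ T e 0) := Ideal.isCoprime_of_le 𝔞.2.2 (lModulus_antitone T e (Nat.zero_le N))
  set 𝔞₀ : LFunctions.CoprimeIdeal (lModulus ℓ T e 0) := ⟨𝔞.1, 𝔞.2.1, h𝔞0⟩ with h𝔞₀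
  letI := LFunctions.rayClassSetoid (lModulus ℓ T e 0)
  set cl : Quotient (LFunctions.rayClassSetoid (lModulus ℓ T e 0)) := Quotient.mk _ 𝔞₀ with hcl
  have hrel : LFunctions.RayClassRel (lModulus ℓ T e 0) 𝔞₀.1 cl.out.1 :=
    (LFunctions.rayClassSetoid_r_iff cl.out 𝔞₀).mp (Quotient.mk_out 𝔞₀)
  obtain ⟨b, c, hb, hc, hcop, hbc, hpos, heq⟩ := hrel
  have hb0 : (Ideal.span {b} : Ideal (𝓞 K)) ≠ ⊥ := by rwa [Ne, Ideal.span_singleton_eq_bot]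
  have hc0 : (Ideal.span {c} : Ideal (𝓞 K)) ≠ ⊥ := by rwa [Ne, Ideal.span_singleton_eq_bot]
  -- `(c) · 𝔞_i = (b) · 𝔞`
  have h1 : χ.lAdicIdealPow ι (Ideal.span {c}) * χ.lAdicIdealPow ι cl.out.1 =
      χ.lAdicIdealPow ι (Ideal.span {b}) * χ.lAdicIdealPow ι 𝔞.1 := by
    rw [← lAdicIdealPow_mul χ ι hc0 cl.out.2.1, ← lAdicIdealPow_mul χ ι hb0 𝔞.2.1, heq]
  have hF := hinf.idealPow_span_eq hmod hb hc (Ideal.isCoprime_of_le hcop (lModulus_le_modulusIdeal T e 0))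
    (lModulus_le_modulusIdeal T e 0 hbc) hpos
  set R : PadicAlgCl ℓ := ι.symm (∏ w : InfinitePlace K, w.embedding ((b : K) / c) ^ (p w) *
    conj (w.embedding ((b : K) / c)) ^ (q w)) with hR
  have hcval : (χ.lAdicIdealPow ι (Ideal.span {c}) : PadicAlgCl ℓ) ≠ 0 := Units.ne_zero _
  have hbval : (χ.lAdicIdealPow ι (Ideal.span {b}) : PadicAlgCl ℓ) = χ.lAdicIdealPow ι (Ideal.span {c}) * R := by
    rw [coe_lAdicIdealPow χ ι hb0, coe_lAdicIdealPow χ ι hc0, hF, map_mul]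
  have h2 := congrArg (fun u : (PadicAlgCl ℓ)ˣ => (u : PadicAlgCl ℓ)) h1
  simp only [Units.val_mul] at h2
  rw [hbval, mul_assoc] at h2
  -- `Ψ(𝔞_i) = R · Ψ(𝔞)`
  have h3 : (χ.lAdicIdealPow ι cl.out.1 : PadicAlgCl ℓ) = R * χ.lAdicIdealPow ι 𝔞.1 := mul_left_cancel₀ hcval h2
  have hRne : R ≠ 0 := by
    intro h0
    rw [h0, zero_mul] at h3
    exact Units.ne_zero _ h3
  have h4 : (χ.lAdicIdealPow ι 𝔞.1 : PadicAlgCl ℓ) = χ.lAdicIdealPow ι cl.out.1 * R⁻¹ := by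
    rw [h3, mul_comm R, mul_assoc, mul_inv_cancel₀ hRne, mul_one]
  rw [h4]
  exact mul_mem (IntermediateField.subset_adjoin _ _ (Or.inr ⟨cl, rfl⟩))
    (inv_mem (ιsymm_archRatio_mem_lAdicValueField χ ι T e p q _ _))

end ValueField

/-! #### Representatives and the limit -/

section Limit

variable {p q : InfinitePlace K → ℤ} (hinf : χ.HasInfinityType p q) (hmod : IsModulus χ T e)
  (ι : PadicAlgCl ℓ ≃+* ℂ)

/-- Two units congruent modulo `U_N` are close: `‖u - v‖ ≤ ‖v‖ ‖ℓ‖^{N+1}` and `‖u‖ = ‖v‖`. [folklore] -/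
theorem norm_sub_le_of_mk_eq {N : ℕ} {u v : (PadicAlgCl ℓ)ˣ}
    (h : (QuotientGroup.mk u : (PadicAlgCl ℓ)ˣ ⧸ lOneUnits ℓ N) = QuotientGroup.mk v) :
    ‖(u : PadicAlgCl ℓ) - v‖ ≤ ‖(v : PadicAlgCl ℓ)‖ * ‖(ℓ : PadicAlgCl ℓ)‖ ^ (N + 1) ∧
      ‖(u : PadicAlgCl ℓ)‖ = ‖(v : PadicAlgCl ℓ)‖ := by
  rw [eq_comm, QuotientGroup.eq, mem_lOneUnits_iff, Units.val_mul, Units.val_inv_eq_inv_val] at h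
  have hv0 : (v : PadicAlgCl ℓ) ≠ 0 := v.ne_zero
  have hlt : ‖(v : PadicAlgCl ℓ)⁻¹ * u - 1‖ < 1 := h.trans_lt (norm_natCast_pow_lt_one (Nat.succ_pos N))
  have hone : ‖(v : PadicAlgCl ℓ)⁻¹ * u‖ = 1 := by
    have hne : ‖(v : PadicAlgCl ℓ)⁻¹ * u - 1‖ ≠ ‖(1 : PadicAlgCl ℓ)‖ := by rw [norm_one]; exact hlt.ne
    have h' := IsUltrametricDist.norm_add_eq_max_of_norm_ne_norm hne
    rw [sub_add_cancel, norm_one] at h'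
    rw [h', max_eq_right hlt.le]
  have heq : (u : PadicAlgCl ℓ) - v = v * ((v : PadicAlgCl ℓ)⁻¹ * u - 1) := by
    rw [mul_sub, mul_one, ← mul_assoc, mul_inv_cancel₀ hv0, one_mul]
  constructor
  · rw [heq, norm_mul]
    exact mul_le_mul_of_nonneg_left h (norm_nonneg _)
  · have : (u : PadicAlgCl ℓ) = v * ((v : PadicAlgCl ℓ)⁻¹ * u) := by rw [← mul_assoc, mul_inv_cancel₀ hv0, one_mul]
    rw [this, norm_mul, hone, mul_one]

/-- An ideal representing `R_N(σ)`: `Ψ(𝔞) mod U_N = R_N(σ)` (a choice in the range `H_N`). [folklore] -/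
def HasInfinityType.repIdeal (N : ℕ) (σ : absoluteGaloisGroup K) : LFunctions.CoprimeIdeal (lModulus ℓ T e N) :=
  (hinf.levelChar hmod ι N σ).2.choose

/-- Defining property of `repIdeal`. [folklore] -/
theorem HasInfinityType.lAdicRayClassFun_repIdeal (N : ℕ) (σ : absoluteGaloisGroup K) :
    lAdicRayClassFun χ ι T e N (hinf.repIdeal hmod ι N σ) =
      ((hinf.levelChar hmod ι N σ : hinf.lAdicRaySubgroup hmod ι N) : (PadicAlgCl ℓ)ˣ ⧸ lOneUnits ℓ N) :=
  (hinf.levelChar hmod ι N σ).2.choose_spec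

/-- **The representative `a_N(σ) = Ψ(𝔞_{N,σ}) ∈ ℚ̄_ℓˣ` of `R_N(σ)`.** [folklore] -/
def HasInfinityType.rep (N : ℕ) (σ : absoluteGaloisGroup K) : (PadicAlgCl ℓ)ˣ :=
  χ.lAdicIdealPow ι (hinf.repIdeal hmod ι N σ).1

/-- `a_N(σ) mod U_N = R_N(σ)`. [folklore] -/
theorem HasInfinityType.mk_rep (N : ℕ) (σ : absoluteGaloisGroup K) :
    (QuotientGroup.mk (hinf.rep hmod ι N σ) : (PadicAlgCl ℓ)ˣ ⧸ lOneUnits ℓ N) =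
      ((hinf.levelChar hmod ι N σ : hinf.lAdicRaySubgroup hmod ι N) : (PadicAlgCl ℓ)ˣ ⧸ lOneUnits ℓ N) :=
  hinf.lAdicRayClassFun_repIdeal hmod ι N σ

/-- `a_N(σ) ∈ E`. [folklore] -/
theorem HasInfinityType.rep_mem (N : ℕ) (σ : absoluteGaloisGroup K) :
    ((hinf.rep hmod ι N σ : (PadicAlgCl ℓ)ˣ) : PadicAlgCl ℓ) ∈ lAdicValueField χ ι T e :=
  hinf.lAdicIdealPow_mem_lAdicValueField hmod ι _

/-- **Compatibility of the representatives**: `a_M(σ) ≡ a_N(σ) mod U_N` for `N ≤ M`. [folklore] -/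
theorem HasInfinityType.mk_rep_of_le {N M : ℕ} (hNM : N ≤ M) (σ : absoluteGaloisGroup K) :
    (QuotientGroup.mk (hinf.rep hmod ι M σ) : (PadicAlgCl ℓ)ˣ ⧸ lOneUnits ℓ N) = QuotientGroup.mk (hinf.rep hmod ι N σ) := by
  rw [hinf.mk_rep hmod ι N σ, ← hinf.map_levelChar_eq hmod ι N hNM σ, ← hinf.mk_rep hmod ι M σ, QuotientGroup.map_mk,
    MonoidHom.id_apply]

/-- The estimates: `‖a_M(σ) - a_N(σ)‖ ≤ ‖a_N(σ)‖ ‖ℓ‖^{N+1}` and `‖a_M(σ)‖ = ‖a_N(σ)‖` for `N ≤ M`. [folklore] -/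
theorem HasInfinityType.norm_rep_sub_rep_le {N M : ℕ} (hNM : N ≤ M) (σ : absoluteGaloisGroup K) :
    ‖((hinf.rep hmod ι M σ : (PadicAlgCl ℓ)ˣ) : PadicAlgCl ℓ) - (hinf.rep hmod ι N σ : (PadicAlgCl ℓ)ˣ)‖ ≤
        ‖((hinf.rep hmod ι N σ : (PadicAlgCl ℓ)ˣ) : PadicAlgCl ℓ)‖ * ‖(ℓ : PadicAlgCl ℓ)‖ ^ (N + 1) ∧
      ‖((hinf.rep hmod ι M σ : (PadicAlgCl ℓ)ˣ) : PadicAlgCl ℓ)‖ = ‖((hinf.rep hmod ι N σ : (PadicAlgCl ℓ)ˣ) : PadicAlgCl ℓ)‖ :=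
  norm_sub_le_of_mk_eq (hinf.mk_rep_of_le hmod ι hNM σ)

/-- The norms `‖a_N(σ)‖` are all equal to `‖a_0(σ)‖`. [folklore] -/
theorem HasInfinityType.norm_rep_eq (N : ℕ) (σ : absoluteGaloisGroup K) :
    ‖((hinf.rep hmod ι N σ : (PadicAlgCl ℓ)ˣ) : PadicAlgCl ℓ)‖ = ‖((hinf.rep hmod ι 0 σ : (PadicAlgCl ℓ)ˣ) : PadicAlgCl ℓ)‖ :=
  (hinf.norm_rep_sub_rep_le hmod ι (Nat.zero_le N) σ).2

/-- **The sequence `a_N(σ)` is Cauchy.** [folklore] -/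
theorem HasInfinityType.cauchySeq_rep (σ : absoluteGaloisGroup K) :
    CauchySeq fun N => ((hinf.rep hmod ι N σ : (PadicAlgCl ℓ)ˣ) : PadicAlgCl ℓ) := by
  refine cauchySeq_of_le_geometric ‖(ℓ : PadicAlgCl ℓ)‖
    (‖((hinf.rep hmod ι 0 σ : (PadicAlgCl ℓ)ˣ) : PadicAlgCl ℓ)‖ * ‖(ℓ : PadicAlgCl ℓ)‖)
    (Automorphic.PadicAlgCl.norm_natCast_p_lt_one ℓ) fun N => ?_
  rw [dist_comm, dist_eq_norm]
  have h := (hinf.norm_rep_sub_rep_le hmod ι (Nat.le_succ N) σ).1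
  rw [hinf.norm_rep_eq hmod ι N σ] at h
  calc _ ≤ ‖((hinf.rep hmod ι 0 σ : (PadicAlgCl ℓ)ˣ) : PadicAlgCl ℓ)‖ * ‖(ℓ : PadicAlgCl ℓ)‖ ^ (N + 1) := h
    _ = _ := by ring

/-- **The limit exists** (`E` is complete and contains the `a_N(σ)`). [folklore] -/
theorem HasInfinityType.exists_tendsto_rep (σ : absoluteGaloisGroup K) :
    ∃ L : PadicAlgCl ℓ, Tendsto (fun N => ((hinf.rep hmod ι N σ : (PadicAlgCl ℓ)ˣ) : PadicAlgCl ℓ)) atTop (𝓝 L) := by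
  obtain ⟨L, -, hL⟩ := cauchySeq_tendsto_of_isComplete (isComplete_lAdicValueField χ ι T e)
    (fun N => hinf.rep_mem hmod ι N σ) (hinf.cauchySeq_rep hmod ι σ)
  exact ⟨L, hL⟩

/-- **Weil's `ℓ`-adic value `R(σ) = lim_N a_N(σ)`.**  Ref: Weil 1956 §2; Serre 1968 Ch. II §2.7–2.8.
[cite: Weil1956, §2] -/
def HasInfinityType.weilValue (σ : absoluteGaloisGroup K) : PadicAlgCl ℓ :=
  (hinf.exists_tendsto_rep hmod ι σ).choose

/-- `a_N(σ) → R(σ)`. [folklore] -/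
theorem HasInfinityType.tendsto_rep (σ : absoluteGaloisGroup K) :
    Tendsto (fun N => ((hinf.rep hmod ι N σ : (PadicAlgCl ℓ)ˣ) : PadicAlgCl ℓ)) atTop (𝓝 (hinf.weilValue hmod ι σ)) :=
  (hinf.exists_tendsto_rep hmod ι σ).choose_spec

/-- `‖R(σ)‖ = ‖a_0(σ)‖`. [folklore] -/
theorem HasInfinityType.norm_weilValue (σ : absoluteGaloisGroup K) :
    ‖hinf.weilValue hmod ι σ‖ = ‖((hinf.rep hmod ι 0 σ : (PadicAlgCl ℓ)ˣ) : PadicAlgCl ℓ)‖ := by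
  have h1 := (hinf.tendsto_rep hmod ι σ).norm
  have h2 : Tendsto (fun N => ‖((hinf.rep hmod ι N σ : (PadicAlgCl ℓ)ˣ) : PadicAlgCl ℓ)‖) atTop
      (𝓝 ‖((hinf.rep hmod ι 0 σ : (PadicAlgCl ℓ)ˣ) : PadicAlgCl ℓ)‖) := by
    simp only [hinf.norm_rep_eq hmod ι]
    exact tendsto_const_nhds
  exact tendsto_nhds_unique h1 h2

/-- `R(σ) ≠ 0`. [folklore] -/
theorem HasInfinityType.weilValue_ne_zero (σ : absoluteGaloisGroup K) : hinf.weilValue hmod ι σ ≠ 0 := by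
  rw [← norm_ne_zero_iff, hinf.norm_weilValue hmod ι σ, norm_ne_zero_iff]
  exact Units.ne_zero _

/-- **`‖R(σ) - a_N(σ)‖ ≤ ‖a_0(σ)‖ ‖ℓ‖^{N+1}`.** [folklore] -/
theorem HasInfinityType.norm_weilValue_sub_rep_le (N : ℕ) (σ : absoluteGaloisGroup K) :
    ‖hinf.weilValue hmod ι σ - (hinf.rep hmod ι N σ : (PadicAlgCl ℓ)ˣ)‖ ≤
      ‖((hinf.rep hmod ι 0 σ : (PadicAlgCl ℓ)ˣ) : PadicAlgCl ℓ)‖ * ‖(ℓ : PadicAlgCl ℓ)‖ ^ (N + 1) := by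
  have h1 : Tendsto (fun M => ‖((hinf.rep hmod ι M σ : (PadicAlgCl ℓ)ˣ) : PadicAlgCl ℓ) - (hinf.rep hmod ι N σ : (PadicAlgCl ℓ)ˣ)‖)
      atTop (𝓝 ‖hinf.weilValue hmod ι σ - (hinf.rep hmod ι N σ : (PadicAlgCl ℓ)ˣ)‖) :=
    ((hinf.tendsto_rep hmod ι σ).sub tendsto_const_nhds).norm
  refine le_of_tendsto h1 (Filter.eventually_atTop.mpr ⟨N, fun M hM => ?_⟩)
  have h := (hinf.norm_rep_sub_rep_le hmod ι hM σ).1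
  rwa [hinf.norm_rep_eq hmod ι N σ] at h

/-- **`R` is multiplicative** (`a_N(στ) ≡ a_N(σ) a_N(τ) mod U_N`). [folklore] -/
theorem HasInfinityType.weilValue_mul (σ τ : absoluteGaloisGroup K) :
    hinf.weilValue hmod ι (σ * τ) = hinf.weilValue hmod ι σ * hinf.weilValue hmod ι τ := by
  have hprod := (hinf.tendsto_rep hmod ι σ).mul (hinf.tendsto_rep hmod ι τ)
  -- `a_N(στ)` and `a_N(σ) a_N(τ)` are congruent modulo `U_N`
  have hcong : ∀ N : ℕ, (QuotientGroup.mk (hinf.rep hmod ι N (σ * τ)) : (PadicAlgCl ℓ)ˣ ⧸ lOneUnits ℓ N) =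
      QuotientGroup.mk (hinf.rep hmod ι N σ * hinf.rep hmod ι N τ) := by
    intro N
    rw [QuotientGroup.mk_mul, hinf.mk_rep hmod ι N, hinf.mk_rep hmod ι N, hinf.mk_rep hmod ι N, map_mul,
      Subgroup.coe_mul]
  have hdist : Tendsto (fun N => dist (((hinf.rep hmod ι N σ : (PadicAlgCl ℓ)ˣ) : PadicAlgCl ℓ) * (hinf.rep hmod ι N τ : (PadicAlgCl ℓ)ˣ))
      ((hinf.rep hmod ι N (σ * τ) : (PadicAlgCl ℓ)ˣ) : PadicAlgCl ℓ)) atTop (𝓝 0) := by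
    have hbound : ∀ N, dist (((hinf.rep hmod ι N σ : (PadicAlgCl ℓ)ˣ) : PadicAlgCl ℓ) * (hinf.rep hmod ι N τ : (PadicAlgCl ℓ)ˣ))
        ((hinf.rep hmod ι N (σ * τ) : (PadicAlgCl ℓ)ˣ) : PadicAlgCl ℓ) ≤
        (‖((hinf.rep hmod ι 0 σ : (PadicAlgCl ℓ)ˣ) : PadicAlgCl ℓ)‖ * ‖((hinf.rep hmod ι 0 τ : (PadicAlgCl ℓ)ˣ) : PadicAlgCl ℓ)‖) *
          ‖(ℓ : PadicAlgCl ℓ)‖ ^ (N + 1) := by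
      intro N
      have h := (norm_sub_le_of_mk_eq (hcong N)).1
      rw [dist_comm, dist_eq_norm]
      rw [Units.val_mul, norm_mul, hinf.norm_rep_eq hmod ι N σ, hinf.norm_rep_eq hmod ι N τ] at h
      exact h
    refine squeeze_zero (fun N => dist_nonneg) hbound ?_
    rw [← mul_zero (‖((hinf.rep hmod ι 0 σ : (PadicAlgCl ℓ)ˣ) : PadicAlgCl ℓ)‖ * ‖((hinf.rep hmod ι 0 τ : (PadicAlgCl ℓ)ˣ) : PadicAlgCl ℓ)‖)]
    refine tendsto_const_nhds.mul ?_
    have := tendsto_pow_atTop_nhds_zero_of_lt_one (norm_nonneg (ℓ : PadicAlgCl ℓ)) (Automorphic.PadicAlgCl.norm_natCast_p_lt_one ℓ)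
    exact this.comp (tendsto_add_atTop_nat 1)
  have hlim := hprod.congr_dist hdist
  exact tendsto_nhds_unique (hinf.tendsto_rep hmod ι (σ * τ)) hlim

/-- `R(1) = 1`. [folklore] -/
theorem HasInfinityType.weilValue_one : hinf.weilValue hmod ι 1 = 1 := by
  have h := hinf.weilValue_mul hmod ι 1 1
  rw [mul_one] at h
  exact (mul_eq_left₀ (hinf.weilValue_ne_zero hmod ι 1)).mp h.symm

/-- **Weil's character as a homomorphism `Γ_K → ℚ̄_ℓˣ`.** [cite: Weil1956, §2] -/
def HasInfinityType.weilHom : absoluteGaloisGroup K →* (PadicAlgCl ℓ)ˣ where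
  toFun σ := Units.mk0 (hinf.weilValue hmod ι σ) (hinf.weilValue_ne_zero hmod ι σ)
  map_one' := Units.ext (hinf.weilValue_one hmod ι)
  map_mul' σ τ := Units.ext (by rw [Units.val_mul, Units.val_mk0, Units.val_mk0, Units.val_mk0]; exact hinf.weilValue_mul hmod ι σ τ)

/-- Unfolding lemma for `weilHom`. [folklore] -/
@[simp] theorem HasInfinityType.coe_weilHom_apply (σ : absoluteGaloisGroup K) :
    ((hinf.weilHom hmod ι σ : (PadicAlgCl ℓ)ˣ) : PadicAlgCl ℓ) = hinf.weilValue hmod ι σ :=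
  rfl

/-- **The key estimate for continuity**: if `R_N(σ) = 1` then `‖R(σ) - 1‖ ≤ ‖ℓ‖^{N+1}`. [folklore] -/
theorem HasInfinityType.norm_weilValue_sub_one_le {N : ℕ} {σ : absoluteGaloisGroup K}
    (hσ : hinf.levelChar hmod ι N σ = 1) :
    ‖hinf.weilValue hmod ι σ - 1‖ ≤ ‖(ℓ : PadicAlgCl ℓ)‖ ^ (N + 1) := by
  have hmk : (QuotientGroup.mk (hinf.rep hmod ι N σ) : (PadicAlgCl ℓ)ˣ ⧸ lOneUnits ℓ N) = QuotientGroup.mk 1 := by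
    rw [hinf.mk_rep hmod ι N σ, hσ, Subgroup.coe_one, QuotientGroup.mk_one]
  obtain ⟨h1, h2⟩ := norm_sub_le_of_mk_eq hmk
  rw [Units.val_one, norm_one, one_mul] at h1
  rw [Units.val_one, norm_one] at h2
  have h3 := hinf.norm_weilValue_sub_rep_le hmod ι N σ
  rw [← hinf.norm_rep_eq hmod ι N σ, h2, one_mul] at h3
  calc ‖hinf.weilValue hmod ι σ - 1‖
      = ‖(hinf.weilValue hmod ι σ - (hinf.rep hmod ι N σ : (PadicAlgCl ℓ)ˣ)) +
          (((hinf.rep hmod ι N σ : (PadicAlgCl ℓ)ˣ) : PadicAlgCl ℓ) - 1)‖ := by rw [sub_add_sub_cancel]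
    _ ≤ max ‖hinf.weilValue hmod ι σ - (hinf.rep hmod ι N σ : (PadicAlgCl ℓ)ˣ)‖
          ‖((hinf.rep hmod ι N σ : (PadicAlgCl ℓ)ˣ) : PadicAlgCl ℓ) - 1‖ := IsUltrametricDist.norm_add_le_max _ _
    _ ≤ _ := max_le h3 h1

/-- **Weil's character is continuous.** [folklore] -/
theorem HasInfinityType.continuous_weilHom : Continuous (hinf.weilHom hmod ι) := by
  -- continuity of the values
  have hval : Continuous fun σ => ((hinf.weilHom hmod ι σ : (PadicAlgCl ℓ)ˣ) : PadicAlgCl ℓ) := by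
    have : Continuous ((Units.coeHom (PadicAlgCl ℓ)).comp (hinf.weilHom hmod ι)) := by
      refine continuous_of_continuousAt_one _ ?_
      rw [ContinuousAt, map_one, Metric.tendsto_nhds]
      intro ε hε
      obtain ⟨N, hN⟩ := exists_pow_lt_of_lt_one hε (Automorphic.PadicAlgCl.norm_natCast_p_lt_one ℓ)
      have hmem : ((hinf.levelChar hmod ι N).ker : Set (absoluteGaloisGroup K)) ∈ 𝓝 (1 : absoluteGaloisGroup K) :=
        (hinf.isOpen_ker_levelChar hmod ι N).mem_nhds (one_mem _)
      filter_upwards [hmem] with σ hσ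
      rw [SetLike.mem_coe, MonoidHom.mem_ker] at hσ
      rw [dist_eq_norm, MonoidHom.comp_apply, Units.coeHom_apply, hinf.coe_weilHom_apply hmod ι]
      calc ‖hinf.weilValue hmod ι σ - 1‖ ≤ ‖(ℓ : PadicAlgCl ℓ)‖ ^ (N + 1) := hinf.norm_weilValue_sub_one_le hmod ι hσ
        _ ≤ ‖(ℓ : PadicAlgCl ℓ)‖ ^ N := pow_le_pow_of_le_one (norm_nonneg _)
            (Automorphic.PadicAlgCl.norm_natCast_p_lt_one ℓ).le (Nat.le_succ N)
        _ < ε := hN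
    exact this
  refine Units.continuous_iff.mpr ⟨hval, ?_⟩
  have : (fun σ => (((hinf.weilHom hmod ι σ)⁻¹ : (PadicAlgCl ℓ)ˣ) : PadicAlgCl ℓ)) =
      (fun σ => ((hinf.weilHom hmod ι σ : (PadicAlgCl ℓ)ˣ) : PadicAlgCl ℓ)) ∘ fun σ => σ⁻¹ := by
    funext σ
    simp only [Function.comp_apply, map_inv]
  rw [this]
  exact hval.comp continuous_inv

/-- **Weil's `ℓ`-adic character** `σ ↦ R(σ)⁻¹` as a rank-one framed Galois representation
`Γ_K →ₜ* GL_1(ℚ̄_ℓ)` (the inverse matches the tree's normalisation `arithFrobPolyOfSatake`: geometric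
Frobenius ↔ uniformizer).  Ref: Weil 1956; Serre 1968 Ch. II §2.8. [cite: Weil1956, §2] -/
def HasInfinityType.weilRep : FramedGaloisRep K (PadicAlgCl ℓ) 1 :=
  ContinuousMonoidHom.comp
    (FramedRep.unitsContinuousMulEquivOfUnique (Fin 1) (PadicAlgCl ℓ) : (PadicAlgCl ℓ)ˣ →ₜ* GL (Fin 1) (PadicAlgCl ℓ))
    ⟨(hinf.weilHom hmod ι)⁻¹, by
      have : ((hinf.weilHom hmod ι)⁻¹ : absoluteGaloisGroup K →* (PadicAlgCl ℓ)ˣ) =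
          (fun u : (PadicAlgCl ℓ)ˣ => u⁻¹) ∘ (hinf.weilHom hmod ι) := by
        funext σ; simp only [MonoidHom.inv_apply, Function.comp_apply]
      change Continuous ((hinf.weilHom hmod ι)⁻¹ : absoluteGaloisGroup K →* (PadicAlgCl ℓ)ˣ)
      rw [this]
      exact continuous_inv.comp (hinf.continuous_weilHom hmod ι)⟩

/-- Matrix entry of `weilRep`: `R(σ)⁻¹`. [folklore] -/
theorem HasInfinityType.weilRep_apply_coe (σ : absoluteGaloisGroup K) (i j : Fin 1) :
    ((hinf.weilRep hmod ι σ : GL (Fin 1) (PadicAlgCl ℓ)) : Matrix (Fin 1) (Fin 1) (PadicAlgCl ℓ)) i j =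
      (hinf.weilValue hmod ι σ)⁻¹ :=
  rfl

/-! #### Unramifiedness and the Frobenius values of Weil's character -/

omit [Fact ℓ.Prime] in
/-- A place outside `T` and not above `ℓ` is prime to every `𝔪_N`. [folklore] -/
theorem isCoprime_lModulus_of_not_mem {v : HeightOneSpectrum (𝓞 K)} (hvT : v ∉ T)
    (hvℓ : ((ℓ : ℕ) : 𝓞 K) ∉ v.asIdeal) (N : ℕ) : IsCoprime v.asIdeal (lModulus ℓ T e N) :=
  v.isCoprime_of_not_le fun h => by
    rcases (lModulus_le_asIdeal_iff T e).mp h with h | h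
    exacts [hvT h, hvℓ h]

/-- **Weil's character kills the inertia groups** above the places outside `T` and not above `ℓ`
(`‖R(σ) - 1‖ ≤ ‖ℓ‖^{N+1}` for every `N`). [folklore] -/
theorem HasInfinityType.weilValue_eq_one_of_mem_inertia {v : HeightOneSpectrum (𝓞 K)} (hvT : v ∉ T)
    (hvℓ : ((ℓ : ℕ) : 𝓞 K) ∉ v.asIdeal) {𝔓 : Ideal (absIntegers (𝓞 K) K)} (h𝔓 : 𝔓 ∈ v.primesAbove)
    {σ : absoluteGaloisGroup K} (hσ : σ ∈ 𝔓.inertia (absoluteGaloisGroup K)) :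
    hinf.weilValue hmod ι σ = 1 := by
  have hle : ∀ N : ℕ, ‖hinf.weilValue hmod ι σ - 1‖ ≤ ‖(ℓ : PadicAlgCl ℓ)‖ ^ (N + 1) := fun N =>
    hinf.norm_weilValue_sub_one_le hmod ι
      (hinf.levelChar_eq_one_of_mem_inertia hmod ι N (isCoprime_lModulus_of_not_mem hvT hvℓ N) h𝔓 hσ)
  have hlim : Tendsto (fun N : ℕ => ‖(ℓ : PadicAlgCl ℓ)‖ ^ (N + 1)) atTop (𝓝 0) :=
    (tendsto_pow_atTop_nhds_zero_of_lt_one (norm_nonneg (ℓ : PadicAlgCl ℓ))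
      (Automorphic.PadicAlgCl.norm_natCast_p_lt_one ℓ)).comp (tendsto_add_atTop_nat 1)
  have h0 : ‖hinf.weilValue hmod ι σ - 1‖ ≤ 0 := ge_of_tendsto' hlim hle
  exact sub_eq_zero.mp (norm_le_zero_iff.mp h0)

/-- **Frobenius values of Weil's character**: `R(Φ) = ι⁻¹(χ(ϖ_v))` for an arithmetic Frobenius `Φ`
above a place `v ∉ T`, `v ∤ ℓ` (`a_N(Φ) ≡ ι⁻¹(χ(ϖ_v)) mod U_N` for every `N`). [folklore] -/
theorem HasInfinityType.weilValue_frob {v : HeightOneSpectrum (𝓞 K)} (hvT : v ∉ T)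
    (hvℓ : ((ℓ : ℕ) : 𝓞 K) ∉ v.asIdeal) {𝔓 : Ideal (absIntegers (𝓞 K) K)} (h𝔓 : 𝔓 ∈ v.primesAbove)
    {Φ : absoluteGaloisGroup K} (hΦ : IsArithFrobAt (𝓞 K) Φ 𝔓) :
    hinf.weilValue hmod ι Φ = ι.symm (χ.valueAtUniformizer v) := by
  have hmk : ∀ N : ℕ, (QuotientGroup.mk (hinf.rep hmod ι N Φ) : (PadicAlgCl ℓ)ˣ ⧸ lOneUnits ℓ N) =
      QuotientGroup.mk (χ.lAdicValue ι v) := fun N => by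
    rw [hinf.mk_rep hmod ι N Φ, hinf.levelChar_frob hmod ι N (isCoprime_lModulus_of_not_mem hvT hvℓ N) h𝔓 hΦ,
      HasInfinityType.coe_lAdicRayClassAt]
  have hlim : Tendsto (fun N => ((hinf.rep hmod ι N Φ : (PadicAlgCl ℓ)ˣ) : PadicAlgCl ℓ)) atTop
      (𝓝 ((χ.lAdicValue ι v : (PadicAlgCl ℓ)ˣ) : PadicAlgCl ℓ)) := by
    set c : ℝ := ‖((χ.lAdicValue ι v : (PadicAlgCl ℓ)ˣ) : PadicAlgCl ℓ)‖ with hc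
    have hr : Tendsto (fun N : ℕ => c * ‖(ℓ : PadicAlgCl ℓ)‖ ^ (N + 1)) atTop (𝓝 0) := by
      rw [← mul_zero c]
      exact tendsto_const_nhds.mul ((tendsto_pow_atTop_nhds_zero_of_lt_one (norm_nonneg (ℓ : PadicAlgCl ℓ))
        (Automorphic.PadicAlgCl.norm_natCast_p_lt_one ℓ)).comp (tendsto_add_atTop_nat 1))
    refine (tendsto_const_nhds (x := ((χ.lAdicValue ι v : (PadicAlgCl ℓ)ˣ) : PadicAlgCl ℓ))).congr_dist ?_
    refine squeeze_zero (fun N => dist_nonneg) (fun N => ?_) hr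
    rw [dist_comm, dist_eq_norm]
    exact (norm_sub_le_of_mk_eq (hmk N)).1
  rw [← coe_lAdicValue χ ι v]
  exact tendsto_nhds_unique (hinf.tendsto_rep hmod ι Φ) hlim

/-- **Weil's representation is unramified** at every place outside `T` and not above `ℓ`. [folklore] -/
theorem HasInfinityType.isUnramifiedAt_weilRep {v : HeightOneSpectrum (𝓞 K)} (hvT : v ∉ T)
    (hvℓ : ((ℓ : ℕ) : 𝓞 K) ∉ v.asIdeal) : (hinf.weilRep hmod ι).IsUnramifiedAt v := by
  intro 𝔓 h𝔓 σ hσ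
  ext i j
  rw [hinf.weilRep_apply_coe hmod ι, hinf.weilValue_eq_one_of_mem_inertia hmod ι hvT hvℓ h𝔓 hσ, inv_one,
    Units.val_one, Subsingleton.elim i j, Matrix.one_apply_eq]

/-- **Frobenius characteristic polynomial of Weil's representation**: `X - ι⁻¹(χ(ϖ_v))⁻¹` at every place
outside `T` and not above `ℓ`. [folklore] -/
theorem HasInfinityType.hasFrobCharpolyAt_weilRep {v : HeightOneSpectrum (𝓞 K)} (hvT : v ∉ T)
    (hvℓ : ((ℓ : ℕ) : 𝓞 K) ∉ v.asIdeal) :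
    (hinf.weilRep hmod ι).HasFrobCharpolyAt v (X - C (ι.symm (χ.valueAtUniformizer v)⁻¹)) := by
  rw [FramedGaloisRep.hasFrobCharpolyAt_iff_of_rank_one]
  intro 𝔓 h𝔓 Φ hΦ
  rw [hinf.weilRep_apply_coe hmod ι, hinf.weilValue_frob hmod ι hvT hvℓ h𝔓 hΦ, map_inv₀]

end Limit

/-! ### §9. Weil's theorem -/

/-- **Weil's theorem (1956): the `ℓ`-adic character of an algebraic Hecke character.**  Let `χ` be an
algebraic Hecke character (type `A₀`, `HeckeCharacter.IsAlgebraic`) of the number field `K`, `ℓ` a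
prime and `ι : ℚ̄_ℓ ≃+* ℂ` a field isomorphism.  Then there is a continuous character
`r : Γ_K → GL_1(ℚ̄_ℓ)` which, at every finite place `v ∤ ℓ` at which `χ` is unramified, is unramified
with arithmetic-Frobenius characteristic polynomial `X - ι⁻¹(χ(ϖ_v))⁻¹`
(`= arithFrobPolyOfSatake ι q_v 1 {χ(ϖ_v)}` of `Automorphic/ReciprocityGLn`; the geometric Frobenius
corresponds to the uniformizer).  This is the case `n = 1` of Harris–Lan–Taylor–Thorne's Theorem A /
Theorem 7.13 ("in the case `n = 1` the result is well known").  Proof: Weil's, through the finite ray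
class groups modulo `𝔪 ℓ^{N+1} ∞` (`levelChar`), class field theory at finite level
(`HeckeCharacter.exists_framedArtinRep_of_isFiniteOrder`), Frobenius density, and the `ℓ`-adic limit
inside the finite extension `ℚ_ℓ(values)` (`weilRep`).
[cite: Weil1956, §1–§2] [cite: SerreAbelianLadic1968, Ch. II §2.7–2.8]
[cite: HarrisLanTaylorThorneRMS2016, Thm. 7.13, p. 232 ("in the case n = 1 the result is well known")] -/
theorem IsAlgebraic.exists_lAdic {χ : HeckeCharacter K} (hχ : χ.IsAlgebraic) (ι : PadicAlgCl ℓ ≃+* ℂ) :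
    ∃ r : FramedGaloisRep K (PadicAlgCl ℓ) 1, ∀ v : HeightOneSpectrum (𝓞 K), ((ℓ : ℕ) : 𝓞 K) ∉ v.asIdeal →
      χ.IsUnramifiedAt v →
        r.IsUnramifiedAt v ∧ r.HasFrobCharpolyAt v (X - C (ι.symm (χ.valueAtUniformizer v)⁻¹)) := by
  obtain ⟨p, q, hinf⟩ := χ.isAlgebraic_iff_exists_hasInfinityType.mp hχ
  obtain ⟨e, hmod⟩ := χ.exists_isModulus_of_ramified
  refine ⟨hinf.weilRep hmod ι, fun v hvℓ hv => ?_⟩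
  have hvT : v ∉ (finite_ramifiedPlaces_holds χ).toFinset := fun h =>
    ((finite_ramifiedPlaces_holds χ).mem_toFinset.mp h) hv
  exact ⟨hinf.isUnramifiedAt_weilRep hmod ι hvT hvℓ, hinf.hasFrobCharpolyAt_weilRep hmod ι hvT hvℓ⟩

end HeckeCharacter

end LAdicRay

end Literature.NumberTheory.GaloisRepresentations

end
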